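import Literature.MathematicalPhysics.QuantumFieldTheory.Balaban1983to89.B3Ineq211ZeroBox

/-!
# `Balaban1983to89.B3GkZeroBoxSeparated` — T. Bałaban, *(Higgs)₂,₃ quantum fields in a finite volume. III. Renormalization*,
# Commun. Math. Phys. **88** (1983) 411–445 [Balaban1983Higgs3], (3.1) p. 432: the KERNEL ESTIMATES behind
# `‖hG_k(Ω,B̃)h′‖_{1,α} ≤ O(1)e^{−δ₀dist(□(v),□(v′))}`, PROVED for the MODEL INSTANCE `A = B̃ = 0`, `Ω = □` a rectangular
# parallelepiped: the zero-field box propagator `G^η_k(□,0;x,x′)`, its lattice derivatives in either variable, the Hölder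
# quotients of these derivatives and the mixed second differences are ALL `≤ C·e^{−δ₀·η|x−x′|_∞}` at SEPARATED arguments
# `η|x−x′|_∞ ≥ ρ > 0`, uniformly in the scale `k ≥ 1`, the box and the window

statement-level skeleton of published theorems with citation tags; proofs where landed; nothing here is a claim about the Yang–Mills mass gap

PDF held: `paper:balaban1983-higgs-2-3-quantum-fields-finite-volume` (journal page = PDF page + 410); p. 420 [PDF 10] (1.32)–(1.33),
p. 424 [PDF 14] (2.5)–(2.6), p. 426 [PDF 16] (2.10)–(2.11) and p. 432 [PDF 22] (3.1) read in the OCR text (`p0010.txt`, `p0014.txt`,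
`p0022.txt`) and on the renders `run/shared/lean/pub/pub-balaban/b2b-balaban-ref1/pages/1983-cmp88-higgs23-III/…-p016-x2.png`.

CITATION HEADER (lean-in-tree rule).  Part of the lit-balaban TYPED SKELETON (HOME `run/shared/lean/pub/lit-balaban/`), Phase 2:
SKELETON row **B3.Eq3.1** (`HOME/lit-balaban-r15/ROWS-B3.md`, fold owner r15; decl of record `B3Sect3Statements.Sect3Data.Ineq31`,
typed p239220 over the ABSTRACT carrier `Sect3Data`, status «typed»); file 1 of 2 of the member «MODEL INSTANCE A = B̃ = 0, Ω = □»
(file 2, `B3Ineq31ZeroBox`, assembles the two-variable norm (1.32) of `hG_kh′` from the estimates below); companion of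
`B3Ineq210ZeroBox`/`B3Ineq212ZeroBox`/`B3Ineq211ZeroBox` (rows B3.Eq2.10–2.12, p253409/p254210/p254934) and of p39's
`B3GkZeroBoxPointwise` (the SHORT-DISTANCE law `|x−x′|^{−(d−1)}e^{−δ|x−x′|}` of the same propagator for `x ≠ x′`; here the complementary
SEPARATED regime, where no power of the distance survives and the Hölder/mixed clauses are added).

WHAT IS PRINTED (B3 p. 432 [PDF 22]): *"Now if two vertices, v, v′ have localizations satisfying dist(□(v), □(v′)) ≥ 1, then we
consider every propagator corresponding to a line connecting these vertices as an external field also. Such a possibility is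
assured by the following estimates ‖hG_k(Ω,B̃)h′‖_{1,α} ≤ O(1)e^{−δ₀dist(□(v),□(v′))}, (3.1) and similarly for the vector field
propagator, h, h′ are localization functions."*; (1.32) p. 420: *"‖f‖_{1,α} = sup_x |f(x)| + sup_{x,μ} |(D^η_{B,μ}f)(x)| +
sup_{x,x′,μ} |x − x′|^{−α}|U(B(Γ_{x,x′}))(D^η_{B,μ}f)(x′) − (D^η_{B,μ}f)(x)|, (1.32) … This definition extends in a natural way to
functions of many variables."*; (2.6)/(2.10) p. 424/426: `G_k(Ω,B̃) = Σ_{j=0}^{k−1}G^η_{(j)}(Ω,B̃)`, *"|G^η_{(j)}(Ω, B̃; x, x′)| ≤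
O(1)(L^jη)^{−d+2}e^{−δ₁(L^jη)^{−1}|x−x′|}, (2.10) and if the propagator is differentiated, then for each differentiation, there is an
additional factor (L^jη)^{−1} on the right side. This applies also to Hölder norms"* (2.11).

WHAT IS REPRODUCED (kind «model-instance», G.1 of `HOME/PHASE2-TARGETS.md`).  For a function of the two lattice variables
`(x, x′) ↦ h(x)G^η_k(□,0;x,x′)h′(x′)` localized in unit cubes at distance `≥ 1`, the norm (1.32) "of many variables" needs, besides
`sup|G^η_k|`, the derivatives in BOTH variables, their Hölder quotients, and — for the quotient of a row derivative between two
points differing in the COLUMN variable — the mixed second difference.  All of these are obtained here for the instance, in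
the counting normalisation of the `A = 0` box lineage (`G^η_k = η^{−(d+1)}G_k`, `η^{−1} = L^k`, `G_k(□,0) = Gfine ℓ k M k a m2 =
(boxOpR (L^k) a_k m² M)⁻¹`, `B3Ineq210ZeroBox.sum_piece(_eq_inv)`), at SEPARATION `η|x−x′|_∞ ≥ ρ`, any `ρ > 0`:
* §0 private copies of the one-centre pointwise triple-product estimate of `B3Ineq210ZeroBox` (private there);
* §1 the scale sum at separation (`scaleSum_sep_le`): `Σ_{j<k} s_j^p e^{−δDs_j} ≤ [p!/(δρ/2)^p(1 − e^{−(δρ/2)L})^{−1}]·e^{−(δL/2)D}`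
  for `D ≥ ρ` (`s_j = L^{k−j} ≥ L`; powers paid by half the exponent, `u^pe^{−cu} ≤ p!/c^p`; the rest a geometric series in
  `e^{−(δD/2)L}` via `L^m ≥ Lm`);
* §2 the NEW piecewise input `abs_pieceMixed_le`: `(L^k)²|G_{(j)}(x+e_μ,x′+e_ν) − G_{(j)}(x,x′+e_ν) − G_{(j)}(x+e_μ,x′) + G_{(j)}(x,x′)|
  ≤ C·L^{−j(d+1)}·e^{−δ₁|x−x′|_∞/L^j}` — (2.10)'s rule «for each differentiation an additional factor (L^jη)^{−1}» applied once in
  each variable: both block rows of `α_j²A_jC_jB_j` differenced (`B4Thm110ZeroBoxDeriv.Gfine_blockRowDiff_bound` twice, the column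
  through `Gfine_isSymm`; `mul3_mixed_sub`), (2.37) in the middle (`B4BoxCov237.cov237_box_decay`); `j = 0` crudely;
* §3 the generic summation `sum_pieces_sep_le` and the SIX kernel clauses, each `∃ δ₀ C > 0 ∀ k ≥ 1, window, box, points with
  η|x−x′|_∞ ≥ ρ`: **`abs_Gk_sep_le`** (value: `η^{−(d+1)}|G_k(x,x′)| ≤ Ce^{−δ₀η|x−x′|_∞}`, from `B3Ineq210ZeroBox.abs_piece_le`),
  **`abs_GkDiff_sep_le`** / **`abs_GkDiff'_sep_le`** (row / column derivative, from `abs_pieceDiff_le` and symmetry),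
  **`abs_GkDD_sep_le`** / **`abs_GkDD'_sep_le`** (Hölder quotient of the row derivative in the row variable / of the column
  derivative in the column variable, per `0 ≤ α < 1`, decay in `dist({x₁,x₂},x)`, from `B3Ineq211ZeroBox.abs_pieceDD_le`),
  **`abs_GkMixed_sep_le`** (mixed second difference, from §2);
* §4 a non-vacuity witness.

HONEST SCOPE / DECLARED DIVERGENCES (F7).  (i) As the companions: only `A = B̃ = 0` (`U ≡ 1`, one component), `Ω = □` a box of unit
blocks with Neumann conditions, all `k ≥ 1`, running constants in a window `[a₋,a₊] × [0,m²₊]`; not general `Ω`, not the torus, not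
`δG_k(Ω,Ω₂,B̃)`.  (ii) Derivatives = forward differences along bonds of `□` in the stated variable.  (iii) Sup norm for distances
(the print does not fix the norm).  (iv) Constants existential, depending on `d`, `L`, the window, `ρ` (and `α` for the Hölder
clauses, as printed for the cited Proposition I.2.1: «c₀ on α also»); exponents not optimised (every power `s_j^{d+1−2}`, `s_j^{d}`,
`s_j^{d+α}` is bounded by `s_j^{d+1}` before summing).  (v) This file does NOT yet speak about `‖·‖_{1,α}` or localization functions —
that assembly (row B3.Eq3.1's `Ineq31` for the instance) is file 2; here only the kernel inequalities, which are the located content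
of «such a possibility is assured by the following estimates» for the instance.  (vi) ROUTE = the print's ((2.6) + (2.10)/(2.11)
summed over the scales, «rescaling … and application of Propositions I.2.1 and I.2.3»), through the kernel-proved `A = 0` box lineage
(`B3Ineq210ZeroBox`, `B3Ineq211ZeroBox`, `B4Thm110ZeroBox(Deriv)`, `B4Thm19ZeroBoxHolder`, `B4BoxCov237`) used BY NAME; theorems
only, no definitions, no Literature fact minted; standard axioms.  Value = kernel certificate of a located by-reference step of B3
for the zero-background box instance, NOT summit progress.
Unit `lit-balaban-p03-g4` (Phase-2 proof seat p03, gen 4); HOME `run/shared/lean/pub/lit-balaban/` (row B3.Eq3.1, FILED.md, STATUS.md).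
-/

namespace Literature.MathematicalPhysics.QuantumFieldTheory.Balaban1983to89.B3GkZeroBoxSeparated

open Finset Matrix
open Literature.MathematicalPhysics.QuantumFieldTheory.Balaban1983to89.B4ContourShift
open Literature.MathematicalPhysics.QuantumFieldTheory.Balaban1983to89.B4Reflection242
open Literature.MathematicalPhysics.QuantumFieldTheory.Balaban1983to89.B4BoxCov237
open Literature.MathematicalPhysics.QuantumFieldTheory.Balaban1983to89.B4Thm110ZeroBox
open Literature.MathematicalPhysics.QuantumFieldTheory.Balaban1983to89.B4Thm110ZeroBoxDeriv
open Literature.MathematicalPhysics.QuantumFieldTheory.Balaban1983to89.B4Thm19ZeroBoxHolder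
open Literature.MathematicalPhysics.QuantumFieldTheory.Balaban1983to89.B3Ineq210ZeroBox
open Literature.MathematicalPhysics.QuantumFieldTheory.Balaban1983to89.B3Ineq211ZeroBox
open B4StripSumsHolder (one_le_supNorm)
open B4Sect5Proof (latticeConst latticeConst_nonneg)

noncomputable section

variable {d : ℕ}

/-! ## §0 Exponential bookkeeping and the one-centre pointwise triple-product estimate
(private copies of the kernels of `B3Ineq210ZeroBox` §1, private there) -/

/-- kernel: three decaying factors along a chain `β → y → y′ → β′` dominate one decaying factor in `D ≤ p + q + r`
at the rate `min(κ,δ)/2`, keeping half of the first two rates for the two summations. [folklore] -/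
private theorem exp_chain3 {κ δ p q r D : ℝ} (hκ : 0 ≤ κ) (hδ : 0 ≤ δ) (hp : 0 ≤ p) (hq : 0 ≤ q) (hr : 0 ≤ r)
    (hD : D ≤ p + q + r) :
    Real.exp (-(κ * p)) * Real.exp (-(δ * q)) * Real.exp (-(κ * r))
      ≤ Real.exp (-(min κ δ / 2 * D)) * (Real.exp (-(κ / 2 * p)) * Real.exp (-(δ / 2 * q))) := by
  simp only [← Real.exp_add]
  apply Real.exp_le_exp.2
  have h1 : min κ δ ≤ κ := min_le_left _ _
  have h2 : min κ δ ≤ δ := min_le_right _ _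
  have h0 : 0 ≤ min κ δ := le_min hκ hδ
  have e1 : min κ δ / 2 * D ≤ min κ δ / 2 * (p + q + r) := mul_le_mul_of_nonneg_left hD (by linarith)
  have e2 : min κ δ / 2 * p ≤ κ / 2 * p := mul_le_mul_of_nonneg_right (by linarith) hp
  have e3 : min κ δ / 2 * q ≤ δ / 2 * q := mul_le_mul_of_nonneg_right (by linarith) hq
  have e4 : min κ δ / 2 * r ≤ κ * r := mul_le_mul_of_nonneg_right (by linarith) hr
  linarith

/-- kernel: `|β − β′|_∞ ≤ |β − y|_∞ + |y − y′|_∞ + |β′ − y′|_∞`. [folklore] -/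
private theorem supNorm_chain (β y y' β' : Fin (d + 1) → ℤ) :
    supNorm (β - β') ≤ supNorm (β - y) + supNorm (y - y') + supNorm (β' - y') := by
  have t1 := supNorm_sub_le_sub_add_sub β y β'
  have t2 := supNorm_sub_le_sub_add_sub y y' β'
  rw [show supNorm (y' - β') = supNorm (β' - y') from by rw [← B4TorusKernel.supNorm_neg, neg_sub]] at t2
  linarith

section Pointwise

variable {N : Fin (d + 1) → ℕ}

/-- kernel: one term of the triple product. [folklore] -/
private theorem term3_le (β β' y y' : ↥(boxDom N)) {gy Cyy hy cA cC cB κ δ : ℝ} (hcA : 0 ≤ cA) (hcC : 0 ≤ cC)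
    (hcB : 0 ≤ cB) (hκ : 0 < κ) (hδ : 0 < δ)
    (hg : |gy| ≤ cA * Real.exp (-(κ * supNorm (β.1 - y.1))))
    (hC : |Cyy| ≤ cC * Real.exp (-(δ * supNorm (y.1 - y'.1))))
    (hh : |hy| ≤ cB * Real.exp (-(κ * supNorm (β'.1 - y'.1)))) :
    |gy * Cyy * hy| ≤ cA * cC * cB * Real.exp (-(min κ δ / 2 * supNorm (β.1 - β'.1)))
      * (Real.exp (-(κ / 2 * supNorm (β.1 - y.1))) * Real.exp (-(δ / 2 * supNorm (y.1 - y'.1)))) := by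
  have n1 : 0 ≤ cA * Real.exp (-(κ * supNorm (β.1 - y.1))) := mul_nonneg hcA (Real.exp_pos _).le
  have n2 : 0 ≤ cC * Real.exp (-(δ * supNorm (y.1 - y'.1))) := mul_nonneg hcC (Real.exp_pos _).le
  have hprod := mul_le_mul (mul_le_mul hg hC (abs_nonneg _) n1) hh (abs_nonneg _) (mul_nonneg n1 n2)
  have hch := exp_chain3 hκ.le hδ.le (supNorm_nonneg (β.1 - y.1)) (supNorm_nonneg (y.1 - y'.1))
    (supNorm_nonneg (β'.1 - y'.1)) (supNorm_chain β.1 y.1 y'.1 β'.1)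
  have hc0 : 0 ≤ cA * cC * cB := mul_nonneg (mul_nonneg hcA hcC) hcB
  calc |gy * Cyy * hy| = |gy| * |Cyy| * |hy| := by rw [abs_mul, abs_mul]
    _ ≤ cA * Real.exp (-(κ * supNorm (β.1 - y.1))) * (cC * Real.exp (-(δ * supNorm (y.1 - y'.1))))
        * (cB * Real.exp (-(κ * supNorm (β'.1 - y'.1)))) := hprod
    _ = cA * cC * cB * (Real.exp (-(κ * supNorm (β.1 - y.1))) * Real.exp (-(δ * supNorm (y.1 - y'.1)))
        * Real.exp (-(κ * supNorm (β'.1 - y'.1)))) := by ring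
    _ ≤ cA * cC * cB * (Real.exp (-(min κ δ / 2 * supNorm (β.1 - β'.1)))
        * (Real.exp (-(κ / 2 * supNorm (β.1 - y.1))) * Real.exp (-(δ / 2 * supNorm (y.1 - y'.1))))) :=
        mul_le_mul_of_nonneg_left hch hc0
    _ = _ := by ring

/-- kernel: the double geometric sum `Σ_y e^{−(κ/2)|β−y|} Σ_{y′} e^{−(δ/2)|y−y′|} ≤ K(κ/2)K(δ/2)`. [folklore] -/
private theorem sum2_exp_le (β : ↥(boxDom N)) {κ δ : ℝ} (hκ : 0 < κ) (hδ : 0 < δ) :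
    ∑ y' : ↥(boxDom N), ∑ y : ↥(boxDom N),
        Real.exp (-(κ / 2 * supNorm (β.1 - y.1))) * Real.exp (-(δ / 2 * supNorm (y.1 - y'.1)))
      ≤ latticeConst (d + 1) (κ / 2) * latticeConst (d + 1) (δ / 2) := by
  have hKδ : 0 ≤ latticeConst (d + 1) (δ / 2) := latticeConst_nonneg _ (half_pos hδ).le
  have hrowδ : ∀ y : ↥(boxDom N), ∑ y' : ↥(boxDom N), Real.exp (-(δ / 2 * supNorm (y.1 - y'.1)))
      ≤ latticeConst (d + 1) (δ / 2) := fun y => rho_sumBound N (δ / 2) (half_pos hδ) y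
  have hrowκ : ∑ y : ↥(boxDom N), Real.exp (-(κ / 2 * supNorm (β.1 - y.1))) ≤ latticeConst (d + 1) (κ / 2) :=
    rho_sumBound N (κ / 2) (half_pos hκ) β
  rw [Finset.sum_comm]
  calc ∑ y : ↥(boxDom N), ∑ y' : ↥(boxDom N),
          Real.exp (-(κ / 2 * supNorm (β.1 - y.1))) * Real.exp (-(δ / 2 * supNorm (y.1 - y'.1)))
      = ∑ y : ↥(boxDom N), Real.exp (-(κ / 2 * supNorm (β.1 - y.1)))
          * ∑ y' : ↥(boxDom N), Real.exp (-(δ / 2 * supNorm (y.1 - y'.1))) := by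
        refine Finset.sum_congr rfl fun y _ => ?_
        rw [Finset.mul_sum]
    _ ≤ ∑ y : ↥(boxDom N), Real.exp (-(κ / 2 * supNorm (β.1 - y.1))) * latticeConst (d + 1) (δ / 2) :=
        Finset.sum_le_sum fun y _ => mul_le_mul_of_nonneg_left (hrowδ y) (Real.exp_pos _).le
    _ = (∑ y : ↥(boxDom N), Real.exp (-(κ / 2 * supNorm (β.1 - y.1)))) * latticeConst (d + 1) (δ / 2) := by
        rw [Finset.sum_mul]
    _ ≤ latticeConst (d + 1) (κ / 2) * latticeConst (d + 1) (δ / 2) :=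
        mul_le_mul_of_nonneg_right hrowκ hKδ

/-- kernel: **THE POINTWISE TRIPLE-PRODUCT ESTIMATE** — for a vector `g` decaying about `β`, a kernel `C` decaying
off the diagonal and a vector `h` decaying about `β′` (all on one unit box, sup-distance, rates `κ, δ, κ`),
`|Σ_{y′}Σ_y g(y)C(y,y′)h(y′)| ≤ c_Ac_Cc_B·K(κ/2)K(δ/2)·e^{−(min(κ,δ)/2)|β−β′|}` — the pointwise twin of the
row-sum bookkeeping of [B4] (2.38)–(2.39) (`B4Thm110ZeroBox.step_term_bound`). [folklore] -/
private theorem abs_sum2_le (β β' : ↥(boxDom N)) (g h : ↥(boxDom N) → ℝ)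
    (C : Matrix ↥(boxDom N) ↥(boxDom N) ℝ) {cA cC cB κ δ : ℝ} (hcA : 0 ≤ cA) (hcC : 0 ≤ cC) (hcB : 0 ≤ cB)
    (hκ : 0 < κ) (hδ : 0 < δ)
    (hg : ∀ y, |g y| ≤ cA * Real.exp (-(κ * supNorm (β.1 - y.1))))
    (hC : ∀ y y', |C y y'| ≤ cC * Real.exp (-(δ * supNorm (y.1 - y'.1))))
    (hh : ∀ y', |h y'| ≤ cB * Real.exp (-(κ * supNorm (β'.1 - y'.1)))) :
    |∑ y' : ↥(boxDom N), ∑ y : ↥(boxDom N), g y * C y y' * h y'|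
      ≤ cA * cC * cB * (latticeConst (d + 1) (κ / 2) * latticeConst (d + 1) (δ / 2))
        * Real.exp (-(min κ δ / 2 * supNorm (β.1 - β'.1))) := by
  have hc1 : 0 ≤ cA * cC * cB * Real.exp (-(min κ δ / 2 * supNorm (β.1 - β'.1))) :=
    mul_nonneg (mul_nonneg (mul_nonneg hcA hcC) hcB) (Real.exp_pos _).le
  have s1 : |∑ y' : ↥(boxDom N), ∑ y : ↥(boxDom N), g y * C y y' * h y'|
      ≤ ∑ y' : ↥(boxDom N), ∑ y : ↥(boxDom N), |g y * C y y' * h y'| :=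
    (Finset.abs_sum_le_sum_abs _ _).trans (Finset.sum_le_sum fun y' _ => Finset.abs_sum_le_sum_abs _ _)
  have s2 : ∑ y' : ↥(boxDom N), ∑ y : ↥(boxDom N), |g y * C y y' * h y'|
      ≤ ∑ y' : ↥(boxDom N), ∑ y : ↥(boxDom N), cA * cC * cB * Real.exp (-(min κ δ / 2 * supNorm (β.1 - β'.1)))
          * (Real.exp (-(κ / 2 * supNorm (β.1 - y.1))) * Real.exp (-(δ / 2 * supNorm (y.1 - y'.1)))) :=
    Finset.sum_le_sum fun y' _ => Finset.sum_le_sum fun y _ =>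
      term3_le β β' y y' hcA hcC hcB hκ hδ (hg y) (hC y y') (hh y')
  have s3 : ∑ y' : ↥(boxDom N), ∑ y : ↥(boxDom N), cA * cC * cB * Real.exp (-(min κ δ / 2 * supNorm (β.1 - β'.1)))
          * (Real.exp (-(κ / 2 * supNorm (β.1 - y.1))) * Real.exp (-(δ / 2 * supNorm (y.1 - y'.1))))
      = cA * cC * cB * Real.exp (-(min κ δ / 2 * supNorm (β.1 - β'.1)))
          * ∑ y' : ↥(boxDom N), ∑ y : ↥(boxDom N), (Real.exp (-(κ / 2 * supNorm (β.1 - y.1)))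
              * Real.exp (-(δ / 2 * supNorm (y.1 - y'.1)))) := by
    rw [Finset.mul_sum]
    refine Finset.sum_congr rfl fun y' _ => ?_
    rw [Finset.mul_sum]
  have s4 := mul_le_mul_of_nonneg_left (sum2_exp_le β hκ hδ) hc1
  calc |∑ y' : ↥(boxDom N), ∑ y : ↥(boxDom N), g y * C y y' * h y'|
      ≤ cA * cC * cB * Real.exp (-(min κ δ / 2 * supNorm (β.1 - β'.1)))
          * (latticeConst (d + 1) (κ / 2) * latticeConst (d + 1) (δ / 2)) := by linarith
    _ = _ := by ring

end Pointwise

/-! ## §1 The sum over the scales at SEPARATED arguments: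
`Σ_{j<k} s_j^p e^{−δ·D·s_j} ≤ C(p,δ,ρ,L)·e^{−(δL/2)·D}` for `D ≥ ρ > 0` (`s_j = L^{k−j} ∈ [L, L^k]`) -/

/-- kernel: `u^p e^{−cu} ≤ p!/c^p` for `u ≥ 0`, `c > 0` (from `(cu)^p/p! ≤ e^{cu}`). [folklore] -/
private theorem pow_mul_exp_neg_le {u c : ℝ} (hu : 0 ≤ u) (hc : 0 < c) (p : ℕ) :
    u ^ p * Real.exp (-(c * u)) ≤ (p.factorial : ℝ) / c ^ p := by
  have hcu : 0 ≤ c * u := mul_nonneg hc.le hu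
  have h := Real.pow_div_factorial_le_exp (c * u) hcu p
  have hp : (0 : ℝ) < p.factorial := by exact_mod_cast Nat.factorial_pos p
  have hcp : 0 < c ^ p := pow_pos hc p
  rw [div_le_iff₀ hp, mul_pow] at h
  rw [le_div_iff₀ hcp, Real.exp_neg]
  have hE := Real.exp_pos (c * u)
  calc u ^ p * (Real.exp (c * u))⁻¹ * c ^ p = c ^ p * u ^ p / Real.exp (c * u) := by
        rw [div_eq_mul_inv]; ring
    _ ≤ (p.factorial : ℝ) := by rw [div_le_iff₀ hE]; linarith

/-- kernel: `L^m ≥ L·m` for `L ≥ 2`, `m ≥ 1`. [folklore] -/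
private theorem mul_le_pow_of_two_le {L : ℝ} (hL : 2 ≤ L) {m : ℕ} (hm : 1 ≤ m) : L * m ≤ L ^ m := by
  induction m, hm using Nat.le_induction with
  | base => simp
  | succ m hm ih =>
    have hL0 : 0 ≤ L := by linarith
    have hm1 : (1 : ℝ) ≤ m := by exact_mod_cast hm
    calc L * ((m + 1 : ℕ) : ℝ) = L * m + L := by push_cast; ring
      _ ≤ L ^ m + L ^ m := by
          refine add_le_add ih ?_
          calc L = L * 1 := (mul_one L).symm
            _ ≤ L * m := mul_le_mul_of_nonneg_left hm1 hL0
            _ ≤ L ^ m := ih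
      _ = 2 * L ^ m := by ring
      _ ≤ L * L ^ m := mul_le_mul_of_nonneg_right hL (pow_nonneg hL0 m)
      _ = L ^ (m + 1) := by ring

/-- kernel: the scales `s_j = L^{k−j}`, `j < k`, are `L^m`, `m = 1, …, k`:
`Σ_{j<k} e^{−c·s_j} ≤ Σ_{m=1}^{k} e^{−cLm} ≤ e^{−cL}/(1 − e^{−cL})` (`L = ℓ + 1 ≥ 2`, `c > 0`). [folklore] -/
private theorem sum_exp_sc_le {ℓ : ℕ} (hℓ : 1 ≤ ℓ) {c : ℝ} (hc : 0 < c) (k : ℕ) :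
    ∑ j ∈ range k, Real.exp (-(c * sc ℓ k j))
      ≤ Real.exp (-(c * ((ℓ : ℝ) + 1))) / (1 - Real.exp (-(c * ((ℓ : ℝ) + 1)))) := by
  set L : ℝ := (ℓ : ℝ) + 1 with hLdef
  have hL2 : 2 ≤ L := by
    have : (1 : ℝ) ≤ ℓ := by exact_mod_cast hℓ
    linarith
  set r : ℝ := Real.exp (-(c * L)) with hr
  have hr0 : 0 < r := Real.exp_pos _
  have hr1 : r < 1 := Real.exp_lt_one_iff.2 (by nlinarith)
  -- each term is at most `r^{k-j}`
  have hterm : ∀ j ∈ range k, Real.exp (-(c * sc ℓ k j)) ≤ r ^ (k - j) := by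
    intro j hj
    have hm : 1 ≤ k - j := by have := mem_range.1 hj; omega
    rw [hr, ← Real.exp_nat_mul, Real.exp_le_exp]
    have h := mul_le_pow_of_two_le hL2 hm
    unfold sc
    nlinarith
  -- reindex `m = k − j`
  have hre : ∑ j ∈ range k, r ^ (k - j) = ∑ m ∈ range k, r ^ (m + 1) := by
    rw [← sum_range_reflect]
    refine sum_congr rfl fun m hm => ?_
    congr 1
    have := mem_range.1 hm
    omega
  have hgeom : ∑ m ∈ range k, r ^ (m + 1) ≤ r / (1 - r) := by
    have h1 : ∑ m ∈ range k, r ^ (m + 1) = r * ∑ m ∈ range k, r ^ m := by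
      rw [mul_sum]
      refine sum_congr rfl fun m _ => ?_
      ring
    rw [h1, geom_sum_eq hr1.ne k]
    have h2 : 0 < 1 - r := by linarith
    rw [show (r ^ k - 1) / (r - 1) = (1 - r ^ k) / (1 - r) from by
      rw [← neg_sub (1 : ℝ) (r ^ k), ← neg_sub (1 : ℝ) r, neg_div_neg_eq]]
    rw [mul_div_assoc']
    refine div_le_div_of_nonneg_right ?_ h2.le
    have : 0 ≤ r ^ k := pow_nonneg hr0.le k
    nlinarith
  calc ∑ j ∈ range k, Real.exp (-(c * sc ℓ k j)) ≤ ∑ j ∈ range k, r ^ (k - j) := sum_le_sum hterm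
    _ = ∑ m ∈ range k, r ^ (m + 1) := hre
    _ ≤ r / (1 - r) := hgeom

/-- **The scale sum at separated arguments.**  For `L = ℓ + 1 ≥ 2`, `δ > 0`, `ρ > 0`, every power `p`, every `k` and every
`D ≥ ρ`: `Σ_{j<k} s_j^p·e^{−δ·D·s_j} ≤ [p!/(δρ/2)^p · (1 − e^{−(δρ/2)L})^{−1}] · e^{−(δL/2)·D}` — below the separation
scale every piece of (2.6)/(2.10) decays at least like the coarsest one (`s_j ≥ L`), and the powers `s_j^p` are paid by half of
the exponent — the summation over the `k` pieces of the decomposition (2.6) *"G_k(Ω,B̃) = Σ_{j=0}^{k−1}G^η_{(j)}(Ω,B̃)"* at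
separated arguments. [cite: Balaban1983Higgs3, (2.6) p.424] -/
theorem scaleSum_sep_le {ℓ : ℕ} (hℓ : 1 ≤ ℓ) {δ ρ : ℝ} (hδ : 0 < δ) (hρ : 0 < ρ) (p k : ℕ) {D : ℝ} (hD : ρ ≤ D) :
    ∑ j ∈ range k, sc ℓ k j ^ p * Real.exp (-(δ * D * sc ℓ k j))
      ≤ ((p.factorial : ℝ) / (δ * ρ / 2) ^ p * (1 - Real.exp (-(δ * ρ / 2 * ((ℓ : ℝ) + 1))))⁻¹)
          * Real.exp (-(δ * ((ℓ : ℝ) + 1) / 2 * D)) := by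
  set L : ℝ := (ℓ : ℝ) + 1 with hLdef
  have hL1 : 1 ≤ L := by have : (0 : ℝ) ≤ ℓ := Nat.cast_nonneg ℓ; linarith
  have hc0 : 0 < δ * ρ / 2 := by positivity
  have hcD : 0 < δ * D / 2 := by have : 0 < D := lt_of_lt_of_le hρ hD; positivity
  set K : ℝ := (p.factorial : ℝ) / (δ * ρ / 2) ^ p with hK
  have hK0 : 0 ≤ K := by positivity
  -- termwise: `s^p e^{−δDs} ≤ K·e^{−(δD/2)s}`
  have hterm : ∀ j ∈ range k, sc ℓ k j ^ p * Real.exp (-(δ * D * sc ℓ k j))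
      ≤ K * Real.exp (-(δ * D / 2 * sc ℓ k j)) := by
    intro j _
    have hs := (sc_pos ℓ k j).le
    have h1 := pow_mul_exp_neg_le hs hc0 p
    have hsplit : Real.exp (-(δ * D * sc ℓ k j))
        ≤ Real.exp (-(δ * ρ / 2 * sc ℓ k j)) * Real.exp (-(δ * D / 2 * sc ℓ k j)) := by
      rw [← Real.exp_add, Real.exp_le_exp]
      nlinarith [mul_nonneg hδ.le hs]
    calc sc ℓ k j ^ p * Real.exp (-(δ * D * sc ℓ k j))
        ≤ sc ℓ k j ^ p * (Real.exp (-(δ * ρ / 2 * sc ℓ k j)) * Real.exp (-(δ * D / 2 * sc ℓ k j))) :=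
          mul_le_mul_of_nonneg_left hsplit (pow_nonneg hs p)
      _ = (sc ℓ k j ^ p * Real.exp (-(δ * ρ / 2 * sc ℓ k j))) * Real.exp (-(δ * D / 2 * sc ℓ k j)) := by ring
      _ ≤ K * Real.exp (-(δ * D / 2 * sc ℓ k j)) := mul_le_mul_of_nonneg_right h1 (Real.exp_pos _).le
  have hS := sum_exp_sc_le hℓ hcD k
  -- the geometric denominators: `1 − e^{−(δD/2)L} ≥ 1 − e^{−(δρ/2)L}`
  have hden0 : 0 < 1 - Real.exp (-(δ * ρ / 2 * L)) := by
    have : Real.exp (-(δ * ρ / 2 * L)) < 1 := Real.exp_lt_one_iff.2 (by nlinarith)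
    linarith
  have hden : 1 - Real.exp (-(δ * ρ / 2 * L)) ≤ 1 - Real.exp (-(δ * D / 2 * L)) := by
    have : Real.exp (-(δ * D / 2 * L)) ≤ Real.exp (-(δ * ρ / 2 * L)) :=
      Real.exp_le_exp.2 (by nlinarith [mul_nonneg hδ.le (by linarith : (0:ℝ) ≤ L)])
    linarith
  have hfrac : Real.exp (-(δ * D / 2 * L)) / (1 - Real.exp (-(δ * D / 2 * L)))
      ≤ (1 - Real.exp (-(δ * ρ / 2 * L)))⁻¹ * Real.exp (-(δ * L / 2 * D)) := by
    rw [div_eq_mul_inv, mul_comm, show δ * L / 2 * D = δ * D / 2 * L from by ring]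
    exact mul_le_mul_of_nonneg_right (inv_anti₀ hden0 hden) (Real.exp_pos _).le
  calc ∑ j ∈ range k, sc ℓ k j ^ p * Real.exp (-(δ * D * sc ℓ k j))
      ≤ ∑ j ∈ range k, K * Real.exp (-(δ * D / 2 * sc ℓ k j)) := sum_le_sum hterm
    _ = K * ∑ j ∈ range k, Real.exp (-(δ * D / 2 * sc ℓ k j)) := by rw [mul_sum]
    _ ≤ K * (Real.exp (-(δ * D / 2 * L)) / (1 - Real.exp (-(δ * D / 2 * L)))) :=
        mul_le_mul_of_nonneg_left hS hK0
    _ ≤ K * ((1 - Real.exp (-(δ * ρ / 2 * L)))⁻¹ * Real.exp (-(δ * L / 2 * D))) :=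
        mul_le_mul_of_nonneg_left hfrac hK0
    _ = _ := by ring


/-! ## §2 The MIXED second difference of the scale pieces:
`(L^k)²·|G_{(j)}(x+e_μ,x′+e_ν) − G_{(j)}(x,x′+e_ν) − G_{(j)}(x+e_μ,x′) + G_{(j)}(x,x′)| ≤ C·L^{−j(d+1)}·e^{−δ₁|x−x′|_∞/L^j}` —
one factor `(L^jη)^{−1}` gained per differentiation, i.e. the printed (2.10) rule *"for each differentiation, there is an
additional factor (L^jη)^{−1}"* for ONE derivative in EACH variable (`(L^jη)^{−d+2−2}` times `η^{d+1}` is `L^{−j(d+1)}`) -/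

/-- kernel: from `n ≤ b(D + 1)`: the block-label decay `e^{−ρD}` is a fine-lattice decay `e^{ρ}·e^{−δ₁n/b}` for every
`δ₁ ≤ ρ` (as in `B3Ineq210ZeroBox`, private there). [folklore] -/
private theorem exp_blk_le {ρ δ₁ n D b : ℝ} (hρ : 0 ≤ ρ) (hδρ : δ₁ ≤ ρ) (hb : 0 < b) (hn : 0 ≤ n)
    (hnD : n ≤ b * (D + 1)) :
    Real.exp (-(ρ * D)) ≤ Real.exp ρ * Real.exp (-(δ₁ * n / b)) := by
  rw [← Real.exp_add]
  apply Real.exp_le_exp.2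
  have h1 : n / b ≤ D + 1 := by rw [div_le_iff₀ hb]; linarith
  have h2 : δ₁ * n / b = δ₁ * (n / b) := by ring
  have h3 : δ₁ * (n / b) ≤ ρ * (n / b) := mul_le_mul_of_nonneg_right hδρ (div_nonneg hn hb.le)
  have h4 : ρ * (n / b) ≤ ρ * (D + 1) := mul_le_mul_of_nonneg_left h1 hρ
  rw [h2]
  linarith

/-- kernel: `b_0 = L^0 = 1`. [folklore] -/
private theorem bj_zero_cast (ℓ : ℕ) : ((bj ℓ 0 : ℕ) : ℝ) = 1 := by simp [bj]

/-- kernel: `L^k = s_0`. [folklore] -/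
private theorem Lk_eq_sc_zero (ℓ k : ℕ) : ((((ℓ + 1) ^ k : ℕ)) : ℝ) = sc ℓ k 0 := by
  simp [sc]

/-- kernel: differencing an indicator-restricted row: `Σ(1_{c}a) − Σ(1_{c}b) = Σ 1_{c}(a − b)`. [folklore] -/
private theorem sum_ite_sub {ι : Type*} (s : Finset ι) (c : ι → Prop) [DecidablePred c] (f g : ι → ℝ) :
    ∑ i ∈ s, (if c i then f i else 0) - ∑ i ∈ s, (if c i then g i else 0)
      = ∑ i ∈ s, (if c i then f i - g i else 0) := by
  rw [← Finset.sum_sub_distrib]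
  refine Finset.sum_congr rfl fun i _ => ?_
  split_ifs <;> simp

/-- kernel: `(L^k)^n·L^{−jn} = s_j^{n}` (`L^k = s_jb_j`). [folklore] -/
private theorem Lk_pow_mul_inv_bj_pow {ℓ k j : ℕ} (hj : j ≤ k) (n : ℕ) :
    ((((ℓ + 1) ^ k : ℕ) : ℝ)) ^ n * ((((bj ℓ j : ℕ) : ℝ)) ^ n)⁻¹ = sc ℓ k j ^ n := by
  have h := sc_mul_bj (ℓ := ℓ) hj
  rw [bj_cast] at h
  have hL : (0 : ℝ) < ((ℓ : ℝ) + 1) ^ j := by positivity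
  push_cast [bj_cast]
  rw [← h, mul_pow]
  field_simp

/-- kernel: `n/b_j = (n/L^k)·s_j` (`L^k = s_jb_j`). [folklore] -/
private theorem div_bj_eq {ℓ k j : ℕ} (hj : j ≤ k) (n : ℝ) :
    n / ((bj ℓ j : ℕ) : ℝ) = n / ((((ℓ + 1) ^ k : ℕ)) : ℝ) * sc ℓ k j := by
  have h := sc_mul_bj (ℓ := ℓ) hj
  have hb : (0 : ℝ) < ((bj ℓ j : ℕ) : ℝ) := by have := bj_pos ℓ j; positivity
  have hs := (sc_pos ℓ k j).ne'
  push_cast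
  rw [← h]
  field_simp
  rw [bj_cast]

/-- kernel: for a lattice neighbour `xe′ = x′ + e_ν` of the SECOND argument: `|x − x′|_∞ ≤ |x − xe′|_∞ + 1`. [folklore] -/
private theorem supNorm_sub_le_nbr' {ν : Fin (d + 1)} {x x' xe' : Fin (d + 1) → ℤ} (hxe' : xe' = x' + Pi.single ν 1) :
    supNorm (x - x') ≤ supNorm (x - xe') + 1 := by
  have h := supNorm_sub_le_nbr (x' := x) hxe'
  rw [show x' - x = -(x - x') from by abel, B4TorusKernel.supNorm_neg,
    show xe' - x = -(x - xe') from by abel, B4TorusKernel.supNorm_neg] at h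
  exact h

/-- kernel: the mixed second difference of a triple matrix product, with scalar weights on the two differenced factors:
`t₁t₂·(((ACB)(p,p′) − (ACB)(q,p′)) − ((ACB)(p,q′) − (ACB)(q,q′))) = Σ_{y′}Σ_y (t₁(A(p,y) − A(q,y)))·C(y,y′)·(t₂(B(y′,p′) − B(y′,q′)))`.
[folklore] -/
private theorem mul3_mixed_sub {α β γ ε : Type*} [Fintype β] [Fintype γ] (A : Matrix α β ℝ) (C : Matrix β γ ℝ)
    (B : Matrix γ ε ℝ) (p q : α) (p' q' : ε) (t₁ t₂ : ℝ) :
    t₁ * t₂ * (((A * C * B) p p' - (A * C * B) q p') - ((A * C * B) p q' - (A * C * B) q q'))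
      = ∑ y', ∑ y, t₁ * (A p y - A q y) * C y y' * (t₂ * (B y' p' - B y' q')) := by
  have h4 : ∀ (r : α) (r' : ε), (A * C * B) r r' = ∑ y', ∑ y, A r y * C y y' * B y' r' := by
    intro r r'
    simp only [Matrix.mul_apply, Finset.sum_mul]
  rw [h4, h4, h4, h4, ← Finset.sum_sub_distrib, ← Finset.sum_sub_distrib, ← Finset.sum_sub_distrib, Finset.mul_sum]
  refine Finset.sum_congr rfl fun y' _ => ?_
  rw [← Finset.sum_sub_distrib, ← Finset.sum_sub_distrib, ← Finset.sum_sub_distrib, Finset.mul_sum]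
  refine Finset.sum_congr rfl fun y _ => ?_
  ring

/-- kernel: the one-step box Green's function `𝒢_1 = s_1^{-2}G_1(□)` decays on the lattice scale (as in `B3Ineq210ZeroBox`,
private there). [folklore] -/
private theorem abs_Gfine_one_le (d ℓ : ℕ) (hℓ : 1 ≤ ℓ) (amin aplus m2plus : ℝ) (ha : 0 < amin) :
    ∃ r C₀ : ℝ, 0 < r ∧ 0 < C₀ ∧ ∀ (k : ℕ), 1 ≤ k → ∀ (a m2 : ℝ), amin ≤ a → a ≤ aplus → 0 ≤ m2 →
      m2 ≤ m2plus → ∀ (M : Fin (d + 1) → ℕ), (∀ i, 1 ≤ M i) → ∀ (x x' : ↥(boxDom (Nf ℓ k M))),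
        |Gfine ℓ k M 1 a m2 x x'| ≤ (sc ℓ k 1 ^ 2)⁻¹ * C₀ * Real.exp (-(r * supNorm (x.1 - x'.1))) := by
  obtain ⟨r, C₀, hr, hC₀, hdec⟩ := boxOpR_L_inv_decay d ℓ hℓ (amin * (1 - ((((ℓ : ℝ) + 1)) ^ 2)⁻¹))
    aplus m2plus (aminus'_pos hℓ ha)
  refine ⟨r, C₀, hr, hC₀, fun k hk a m2 h1 h2 h3 h4 M hM x x' => ?_⟩
  have ha0 : 0 < a := lt_of_lt_of_le ha h1
  obtain ⟨hw1, hw2, -⟩ := aSeq_window hℓ ha h1 h2 (le_refl 1)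
  rcases Nat.lt_or_ge k 2 with hk2 | hk2
  · obtain rfl : k = 1 := by omega
    have hG : Gfine ℓ 1 M 1 a m2 = (boxOpR ((ℓ + 1) ^ 1) (B1.aSeq a ((ℓ : ℝ) + 1) 1) m2 M)⁻¹ := by
      unfold Gfine
      rw [fineOp_top]
    rw [hG, sc_self, one_pow, inv_one, one_mul]
    exact hdec ((ℓ + 1) ^ 1) (pow_one _) _ _ hw1 hw2 h3 h4 M x x'
  · have hs : 0 < sc ℓ k 1 ^ 2 := pow_pos (sc_pos ℓ k 1) 2
    have hm' : 0 ≤ m2 / sc ℓ k 1 ^ 2 := div_nonneg h3 hs.le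
    have hm'' : m2 / sc ℓ k 1 ^ 2 ≤ m2plus := (div_le_self h3 (one_le_pow₀ (one_le_sc ℓ k 1))).trans h4
    rw [Gfine_apply hℓ (le_refl 1) hk2 hM ha0 h3 x x', abs_mul, abs_of_pos (inv_pos.2 hs), mul_assoc]
    exact mul_le_mul_of_nonneg_left
      (hdec (bj ℓ 1) (pow_one _) _ _ hw1 hw2 hm' hm'' (Mj ℓ k M 1) ((ej ℓ k M 1 hk2).symm x)
        ((ej ℓ k M 1 hk2).symm x')) (inv_pos.2 hs).le

set_option maxHeartbeats 1600000 in
/-- **(2.10)'s differentiation rule applied once in EACH variable, for the model instance `A = B̃ = 0`, `Ω = □`, piecewise,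
counting normalisation**: there are `δ₁ > 0`, `C > 0` (on `d`, `L`, the window) such that for every `k ≥ 1`, `j < k`, window
point, box, axes `μ, ν`, lattice neighbours `xe = x + e_μ`, `xe′ = x′ + e_ν` in `□`:
`(L^k)²·|(G_{(j)}(xe,xe′) − G_{(j)}(x,xe′)) − (G_{(j)}(xe,x′) − G_{(j)}(x,x′))| ≤ C·L^{−j(d+1)}·e^{−δ₁|x−x′|_∞/L^j}` — the printed
`O(1)(L^jη)^{−d+2}·(L^jη)^{−1}·(L^jη)^{−1}` times `η^{d+1}`.  Route: for `1 ≤ j < k` the piece is `α_j²A_jC_jB_j`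
(`B3Ineq210ZeroBox.piece_eq_ACB`); the mixed difference is `α_j²Σ_{y′,y}(L^kΔ_μA_j)(x,y)C_j(y,y′)(L^kΔ_νB_j)(y′,x′)` (`mul3_mixed_sub`),
both differenced block rows bounded by the DERIVATIVE form of [B4] (2.35) (`B4Thm110ZeroBoxDeriv.Gfine_blockRowDiff_bound`, the column
one through `Gfine_isSymm`), `C_j` by (2.37) (`B4BoxCov237.cov237_box_decay`), assembled by the pointwise triple-product estimate;
`j = 0` crudely (four values of `𝒢_1`, `(L^k)²s_1^{−2} = L²`). [cite: Balaban1983Higgs3, (2.10) p.426] -/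
theorem abs_pieceMixed_le (d ℓ : ℕ) (hℓ : 1 ≤ ℓ) (amin aplus m2plus : ℝ) (ha : 0 < amin) :
    ∃ δ₁ C : ℝ, 0 < δ₁ ∧ 0 < C ∧ ∀ (k : ℕ), 1 ≤ k → ∀ (j : ℕ), j < k → ∀ (a m2 : ℝ), amin ≤ a → a ≤ aplus →
      0 ≤ m2 → m2 ≤ m2plus → ∀ (M : Fin (d + 1) → ℕ), (∀ i, 1 ≤ M i) →
        ∀ (μ ν : Fin (d + 1)) (x xe : ↥(boxDom (Nf ℓ k M))), xe.1 = x.1 + Pi.single μ 1 →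
        ∀ (x' xe' : ↥(boxDom (Nf ℓ k M))), xe'.1 = x'.1 + Pi.single ν 1 →
          ((((ℓ + 1) ^ k : ℕ)) : ℝ) ^ 2 * |(piece ℓ k M j a m2 xe xe' - piece ℓ k M j a m2 x xe')
              - (piece ℓ k M j a m2 xe x' - piece ℓ k M j a m2 x x')|
            ≤ C * ((((bj ℓ j : ℕ) : ℝ) ^ (d + 1))⁻¹)
              * Real.exp (-(δ₁ * supNorm (x.1 - x'.1) / ((bj ℓ j : ℕ) : ℝ))) := by
  obtain ⟨r, C₀, hr, hC₀, hone⟩ := abs_Gfine_one_le d ℓ hℓ amin aplus m2plus ha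
  obtain ⟨κ', C', hκ', hC', hRD⟩ := Gfine_blockRowDiff_bound d ℓ hℓ amin aplus m2plus ha
  obtain ⟨δ, c₂, hδ, hc₂, hCov⟩ := cov237_box_decay d ℓ hℓ (amin * (1 - ((((ℓ : ℝ) + 1)) ^ 2)⁻¹)) aplus
    m2plus amin aplus (aminus'_pos hℓ ha) ha
  have hKκ : 0 ≤ latticeConst (d + 1) (κ' / 2) := latticeConst_nonneg _ (half_pos hκ').le
  have hKδ : 0 ≤ latticeConst (d + 1) (δ / 2) := latticeConst_nonneg _ (half_pos hδ).le
  have hρ0 : 0 < min κ' δ / 2 := half_pos (lt_min hκ' hδ)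
  have hL : (0 : ℝ) < (ℓ : ℝ) + 1 := by positivity
  have hCmid : 0 ≤ aplus ^ 2 * (C' * c₂ * C') * (latticeConst (d + 1) (κ' / 2) * latticeConst (d + 1) (δ / 2))
      * Real.exp (min κ' δ / 2) :=
    mul_nonneg (mul_nonneg (mul_nonneg (sq_nonneg _) (mul_nonneg (mul_nonneg hC' hc₂.le) hC'))
      (mul_nonneg hKκ hKδ)) (Real.exp_pos _).le
  have hCzero : 0 < 4 * (C₀ * Real.exp (2 * r) * ((ℓ : ℝ) + 1) ^ 2) := by positivity
  refine ⟨min (min κ' δ / 2) r, 4 * (C₀ * Real.exp (2 * r) * ((ℓ : ℝ) + 1) ^ 2)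
      + aplus ^ 2 * (C' * c₂ * C') * (latticeConst (d + 1) (κ' / 2) * latticeConst (d + 1) (δ / 2))
        * Real.exp (min κ' δ / 2), lt_min hρ0 hr, by linarith, ?_⟩
  intro k hk j hjk a m2 h1 h2 h3 h4 M hM μ ν x xe hxe x' xe' hxe'
  have ha0 : 0 < a := lt_of_lt_of_le ha h1
  have hn0 : 0 ≤ supNorm (x.1 - x'.1) := supNorm_nonneg _
  have hLk : (0 : ℝ) < (((ℓ + 1) ^ k : ℕ) : ℝ) := by positivity
  rcases Nat.eq_zero_or_pos j with rfl | hj1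
  · -- `j = 0`: the four values of the one-step Green's function
    rw [piece_zero, bj_zero_cast, one_pow, inv_one, div_one]
    have g1 := hone k hk a m2 h1 h2 h3 h4 M hM xe xe'
    have g2 := hone k hk a m2 h1 h2 h3 h4 M hM x xe'
    have g3 := hone k hk a m2 h1 h2 h3 h4 M hM xe x'
    have g4 := hone k hk a m2 h1 h2 h3 h4 M hM x x'
    have hs1 : 0 < sc ℓ k 1 ^ 2 := pow_pos (sc_pos ℓ k 1) 2
    have hs1i : 0 ≤ (sc ℓ k 1 ^ 2)⁻¹ := (inv_pos.2 hs1).le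
    have hs0 : sc ℓ k 0 = ((ℓ : ℝ) + 1) * sc ℓ k 1 := sc_eq_succ (by omega : 0 + 1 ≤ k)
    have n1 : supNorm (x.1 - x'.1) ≤ supNorm (xe.1 - xe'.1) + 2 := by
      have a1 := supNorm_sub_le_nbr (x' := x'.1) hxe
      have a2 := supNorm_sub_le_nbr' (x := xe.1) hxe'
      linarith
    have n2 : supNorm (x.1 - x'.1) ≤ supNorm (x.1 - xe'.1) + 2 := by
      have a2 := supNorm_sub_le_nbr' (x := x.1) hxe'
      linarith
    have n3 : supNorm (x.1 - x'.1) ≤ supNorm (xe.1 - x'.1) + 2 := by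
      have a1 := supNorm_sub_le_nbr (x' := x'.1) hxe
      linarith
    have hE : ∀ {t : ℝ}, supNorm (x.1 - x'.1) ≤ t + 2 →
        Real.exp (-(r * t)) ≤ Real.exp (2 * r) * Real.exp (-(r * supNorm (x.1 - x'.1))) := by
      intro t ht
      rw [← Real.exp_add]
      exact Real.exp_le_exp.2 (by nlinarith)
    have hC0' : 0 ≤ (sc ℓ k 1 ^ 2)⁻¹ * C₀ := mul_nonneg hs1i hC₀.le
    have b1 := g1.trans (mul_le_mul_of_nonneg_left (hE n1) hC0')
    have b2 := g2.trans (mul_le_mul_of_nonneg_left (hE n2) hC0')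
    have b3 := g3.trans (mul_le_mul_of_nonneg_left (hE n3) hC0')
    have b4 := g4.trans (mul_le_mul_of_nonneg_left (hE (by linarith)) hC0')
    have h4 : |(Gfine ℓ k M 1 a m2 xe xe' - Gfine ℓ k M 1 a m2 x xe')
          - (Gfine ℓ k M 1 a m2 xe x' - Gfine ℓ k M 1 a m2 x x')|
        ≤ |Gfine ℓ k M 1 a m2 xe xe'| + |Gfine ℓ k M 1 a m2 x xe'|
          + (|Gfine ℓ k M 1 a m2 xe x'| + |Gfine ℓ k M 1 a m2 x x'|) :=
      (abs_sub _ _).trans (add_le_add (abs_sub _ _) (abs_sub _ _))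
    have heq : (((ℓ + 1) ^ k : ℕ) : ℝ) ^ 2 * (4 * ((sc ℓ k 1 ^ 2)⁻¹ * C₀ * Real.exp (2 * r)))
        = 4 * (C₀ * Real.exp (2 * r) * ((ℓ : ℝ) + 1) ^ 2) := by
      rw [Lk_eq_sc_zero, hs0]
      have := (sc_pos ℓ k 1).ne'
      field_simp
    have hexp : Real.exp (-(r * supNorm (x.1 - x'.1)))
        ≤ Real.exp (-(min (min κ' δ / 2) r * supNorm (x.1 - x'.1))) :=
      exp_rate_mono (min_le_right _ _) hn0
    calc (((ℓ + 1) ^ k : ℕ) : ℝ) ^ 2 * |(Gfine ℓ k M 1 a m2 xe xe' - Gfine ℓ k M 1 a m2 x xe')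
            - (Gfine ℓ k M 1 a m2 xe x' - Gfine ℓ k M 1 a m2 x x')|
        ≤ (((ℓ + 1) ^ k : ℕ) : ℝ) ^ 2 * (4 * ((sc ℓ k 1 ^ 2)⁻¹ * C₀
            * (Real.exp (2 * r) * Real.exp (-(r * supNorm (x.1 - x'.1)))))) :=
          mul_le_mul_of_nonneg_left (h4.trans (by linarith)) (pow_nonneg hLk.le 2)
      _ = (((ℓ + 1) ^ k : ℕ) : ℝ) ^ 2 * (4 * ((sc ℓ k 1 ^ 2)⁻¹ * C₀ * Real.exp (2 * r)))
            * Real.exp (-(r * supNorm (x.1 - x'.1))) := by ring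
      _ = 4 * (C₀ * Real.exp (2 * r) * ((ℓ : ℝ) + 1) ^ 2) * Real.exp (-(r * supNorm (x.1 - x'.1))) := by rw [heq]
      _ ≤ 4 * (C₀ * Real.exp (2 * r) * ((ℓ : ℝ) + 1) ^ 2)
            * Real.exp (-(min (min κ' δ / 2) r * supNorm (x.1 - x'.1))) :=
          mul_le_mul_of_nonneg_left hexp hCzero.le
      _ ≤ _ := by
          rw [mul_one]
          exact mul_le_mul_of_nonneg_right (by linarith) (Real.exp_pos _).le
  · -- `1 ≤ j ≤ k − 1`: both block rows differenced
    have hj : j + 1 ≤ k := by omega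
    obtain ⟨hw1, hw2, hapos⟩ := aSeq_window hℓ ha h1 h2 hj1
    have hs : 0 < sc ℓ k j ^ 2 := pow_pos (sc_pos ℓ k j) 2
    have hsi : 0 < (sc ℓ k j ^ 2)⁻¹ := inv_pos.2 hs
    have hs1i : 0 < (sc ℓ k j)⁻¹ := inv_pos.2 (sc_pos ℓ k j)
    have hsc0 : sc ℓ k j ≠ 0 := (sc_pos ℓ k j).ne'
    have hm' : 0 ≤ m2 / sc ℓ k j ^ 2 := div_nonneg h3 hs.le
    have hm'' : m2 / sc ℓ k j ^ 2 ≤ m2plus := (div_le_self h3 (one_le_pow₀ (one_le_sc ℓ k j))).trans h4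
    have hb1 : 1 ≤ bj ℓ j := bj_pos ℓ j
    have hbR : (0 : ℝ) < ((bj ℓ j : ℕ) : ℝ) := by positivity
    have hbD : (0 : ℝ) < ((bj ℓ j : ℕ) : ℝ) ^ (d + 1) := by positivity
    -- the differenced row of `A_j` at `x`, scaled by `L^k`
    have hg : ∀ (y : ↥(boxDom (Mj ℓ k M j))),
        |(((ℓ + 1) ^ k : ℕ) : ℝ) * (Amat ℓ k M j a m2 xe y - Amat ℓ k M j a m2 x y)|
          ≤ (sc ℓ k j)⁻¹ * C' * Real.exp (-(κ' * supNorm (blk (bj ℓ j) x.1 - y.1))) := by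
      intro y
      have hAd : Amat ℓ k M j a m2 xe y - Amat ℓ k M j a m2 x y
          = ∑ x'', (if blk (bj ℓ j) x''.1 = y.1 then Gfine ℓ k M j a m2 xe x'' - Gfine ℓ k M j a m2 x x''
              else 0) := by
        simp only [Amat, Matrix.mul_apply, QksM, Matrix.of_apply, mul_ite, mul_one, mul_zero]
        exact sum_ite_sub _ _ _ _
      rw [hAd]
      exact hRD k j hj1 hj a m2 h1 h2 h3 h4 M hM μ x xe hxe y.1 y.2
    -- the differenced column of `B_j` at `x′`, scaled by `L^k` (a differenced row of `𝒢_j` by symmetry)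
    have hB : ∀ (y' : ↥(boxDom (Mj ℓ k M j))),
        |(((ℓ + 1) ^ k : ℕ) : ℝ) * (Bmat ℓ k M j a m2 y' xe' - Bmat ℓ k M j a m2 y' x')|
          ≤ ((((bj ℓ j : ℕ) : ℝ)) ^ (d + 1))⁻¹ * ((sc ℓ k j)⁻¹ * C')
            * Real.exp (-(κ' * supNorm (blk (bj ℓ j) x'.1 - y'.1))) := by
      intro y'
      have hBe : ∀ z : ↥(boxDom (Nf ℓ k M)), Bmat ℓ k M j a m2 y' z = ((((bj ℓ j : ℕ) : ℝ)) ^ (d + 1))⁻¹ *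
          ∑ w, (if blk (bj ℓ j) w.1 = y'.1 then Gfine ℓ k M j a m2 z w else 0) := by
        intro z
        simp only [Bmat, Matrix.mul_apply, QkM, Matrix.of_apply, Finset.mul_sum]
        refine Finset.sum_congr rfl fun w _ => ?_
        split_ifs with hw
        · rw [(Gfine_isSymm ℓ k M j a m2).apply z w]
        · rw [zero_mul, mul_zero]
      rw [hBe, hBe, ← mul_sub, sum_ite_sub, mul_left_comm, abs_mul, abs_of_pos (inv_pos.2 hbD), mul_assoc]
      exact mul_le_mul_of_nonneg_left (hRD k j hj1 hj a m2 h1 h2 h3 h4 M hM ν x' xe' hxe' y'.1 y'.2)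
        (inv_pos.2 hbD).le
    have hC : ∀ (y y' : ↥(boxDom (Mj ℓ k M j))),
        |Cmat ℓ k M j a m2 y y'| ≤ (sc ℓ k j ^ 2)⁻¹ * c₂ * Real.exp (-(δ * supNorm (y.1 - y'.1))) := by
      intro y y'
      have h := (hCov (bj ℓ j) hb1 _ _ a hw1 hw2 hm' hm'' h1 h2 (Mp ℓ k M j) (Mp_pos hM)).2 y y'
      rw [Cmat, Matrix.smul_apply, smul_eq_mul, abs_mul, abs_of_pos hsi, mul_assoc]
      exact mul_le_mul_of_nonneg_left h hsi.le
    -- the pointwise triple-product estimate for the two differenced factors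
    have key := abs_sum2_le (N := Mj ℓ k M j) ⟨blk (bj ℓ j) x.1, blk_bj_mem hj M x⟩
      ⟨blk (bj ℓ j) x'.1, blk_bj_mem hj M x'⟩
      (fun y => (((ℓ + 1) ^ k : ℕ) : ℝ) * (Amat ℓ k M j a m2 xe y - Amat ℓ k M j a m2 x y))
      (fun y' => (((ℓ + 1) ^ k : ℕ) : ℝ) * (Bmat ℓ k M j a m2 y' xe' - Bmat ℓ k M j a m2 y' x'))
      (Cmat ℓ k M j a m2) (mul_nonneg hs1i.le hC')
      (mul_nonneg hsi.le hc₂.le) (mul_nonneg (inv_pos.2 hbD).le (mul_nonneg hs1i.le hC')) hκ' hδ hg hC hB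
    rw [← mul3_mixed_sub] at key
    have hα : αj a ℓ k j ^ 2 ≤ aplus ^ 2 * (sc ℓ k j ^ 2) ^ 2 := by
      unfold αj
      rw [mul_pow]
      exact mul_le_mul_of_nonneg_right (pow_le_pow_left₀ hapos.le hw2 2) (by positivity)
    have hE := exp_blk_le (δ₁ := min (min κ' δ / 2) r) hρ0.le (min_le_left _ _) hbR hn0
      (supNorm_sub_le_blk hb1 x.1 x'.1)
    have hP0 : 0 ≤ (sc ℓ k j)⁻¹ * C' * ((sc ℓ k j ^ 2)⁻¹ * c₂)
        * (((((bj ℓ j : ℕ) : ℝ)) ^ (d + 1))⁻¹ * ((sc ℓ k j)⁻¹ * C'))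
        * (latticeConst (d + 1) (κ' / 2) * latticeConst (d + 1) (δ / 2)) :=
      mul_nonneg (mul_nonneg (mul_nonneg (mul_nonneg hs1i.le hC') (mul_nonneg hsi.le hc₂.le))
        (mul_nonneg (inv_pos.2 hbD).le (mul_nonneg hs1i.le hC'))) (mul_nonneg hKκ hKδ)
    have hsplit : (((ℓ + 1) ^ k : ℕ) : ℝ) ^ 2 * |(piece ℓ k M j a m2 xe xe' - piece ℓ k M j a m2 x xe')
          - (piece ℓ k M j a m2 xe x' - piece ℓ k M j a m2 x x')|
        = αj a ℓ k j ^ 2 * |(((ℓ + 1) ^ k : ℕ) : ℝ) * (((ℓ + 1) ^ k : ℕ) : ℝ) *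
            (((Amat ℓ k M j a m2 * Cmat ℓ k M j a m2 * Bmat ℓ k M j a m2) xe xe'
              - (Amat ℓ k M j a m2 * Cmat ℓ k M j a m2 * Bmat ℓ k M j a m2) x xe')
            - ((Amat ℓ k M j a m2 * Cmat ℓ k M j a m2 * Bmat ℓ k M j a m2) xe x'
              - (Amat ℓ k M j a m2 * Cmat ℓ k M j a m2 * Bmat ℓ k M j a m2) x x'))| := by
      rw [piece_eq_ACB hℓ hj1 hj hM ha0 h3]
      simp only [Matrix.smul_apply, smul_eq_mul]
      rw [← mul_sub, ← mul_sub, ← mul_sub, abs_mul, abs_of_nonneg (sq_nonneg _), abs_mul, abs_mul,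
        abs_of_pos hLk]
      ring
    rw [hsplit]
    calc αj a ℓ k j ^ 2 * |(((ℓ + 1) ^ k : ℕ) : ℝ) * (((ℓ + 1) ^ k : ℕ) : ℝ) *
            (((Amat ℓ k M j a m2 * Cmat ℓ k M j a m2 * Bmat ℓ k M j a m2) xe xe'
              - (Amat ℓ k M j a m2 * Cmat ℓ k M j a m2 * Bmat ℓ k M j a m2) x xe')
            - ((Amat ℓ k M j a m2 * Cmat ℓ k M j a m2 * Bmat ℓ k M j a m2) xe x'
              - (Amat ℓ k M j a m2 * Cmat ℓ k M j a m2 * Bmat ℓ k M j a m2) x x'))|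
        ≤ (aplus ^ 2 * (sc ℓ k j ^ 2) ^ 2) *
            ((sc ℓ k j)⁻¹ * C' * ((sc ℓ k j ^ 2)⁻¹ * c₂)
              * (((((bj ℓ j : ℕ) : ℝ)) ^ (d + 1))⁻¹ * ((sc ℓ k j)⁻¹ * C'))
              * (latticeConst (d + 1) (κ' / 2) * latticeConst (d + 1) (δ / 2))
              * (Real.exp (min κ' δ / 2)
                  * Real.exp (-(min (min κ' δ / 2) r * supNorm (x.1 - x'.1) / ((bj ℓ j : ℕ) : ℝ))))) :=
          mul_le_mul hα (key.trans (mul_le_mul_of_nonneg_left hE hP0)) (abs_nonneg _) (by positivity)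
      _ = aplus ^ 2 * (C' * c₂ * C') * (latticeConst (d + 1) (κ' / 2) * latticeConst (d + 1) (δ / 2))
            * Real.exp (min κ' δ / 2)
            * ((((bj ℓ j : ℕ) : ℝ) ^ (d + 1))⁻¹)
            * Real.exp (-(min (min κ' δ / 2) r * supNorm (x.1 - x'.1) / ((bj ℓ j : ℕ) : ℝ))) := by
          field_simp
      _ ≤ _ := by
          refine mul_le_mul_of_nonneg_right (mul_le_mul_of_nonneg_right (by linarith) ?_) (Real.exp_pos _).le
          exact (inv_pos.2 hbD).le


/-! ## §3 Summation over the scales at separated arguments: the kernel estimates behind (3.1)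

`G_k(□,0) = Σ_{j<k} G^η_{(j)}` (`B3Ineq210ZeroBox.sum_piece`: `= Gfine ℓ k M k a m2 = (boxOpR (L^k) a_k m² M)⁻¹`,
`sum_piece_eq_inv`).  In the print's normalisation `G^η_k(x,x′) = η^{−(d+1)}G_k(x,x′)`, `η = L^{−k}`, `dist = η|x−x′|_∞`:
every piecewise bound `C·L^{−j(d+1)}·w_j·e^{−δ₁|x−x′|_∞/L^j}` with `0 ≤ w_j ≤ 1` sums, for `dist ≥ ρ`, to `C·C(ρ)·e^{−(δ₁L/2)·dist}`. -/

/-- **The generic summation at separation `ρ`.**  If `|T_j| ≤ C·(L^{−j(d+1)}·w_j)·e^{−δ₁n/L^j}` for `j < k` with `0 ≤ w_j ≤ 1`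
and `n ≥ ρL^k` (`ρ > 0`), then `(L^k)^{d+1}·|Σ_{j<k}T_j| ≤ C·[(d+1)!/(δ₁ρ/2)^{d+1}·(1 − e^{−(δ₁ρ/2)L})^{−1}]·e^{−(δ₁L/2)·(n/L^k)}`
(`(L^k)^{d+1}L^{−j(d+1)} = s_j^{d+1}`, `n/L^j = (n/L^k)s_j`, `scaleSum_sep_le`) — the decomposition (2.6) with the piecewise
bounds (2.10)/(2.11) summed, as the print uses it («decomposing all the propagators … according to the equality (2.6)», p. 424).
[cite: Balaban1983Higgs3, (2.6) p.424] -/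
theorem sum_pieces_sep_le {ℓ : ℕ} (hℓ : 1 ≤ ℓ) {δ₁ ρ Cx : ℝ} (hδ₁ : 0 < δ₁) (hρ : 0 < ρ) (hCx : 0 ≤ Cx) {k : ℕ}
    (T w : ℕ → ℝ) (hw : ∀ j, j < k → 0 ≤ w j ∧ w j ≤ 1) {n : ℝ}
    (hn : ρ * ((((ℓ + 1) ^ k : ℕ)) : ℝ) ≤ n)
    (hT : ∀ j, j < k → |T j| ≤ Cx * ((((bj ℓ j : ℕ) : ℝ) ^ (d + 1))⁻¹ * w j)
        * Real.exp (-(δ₁ * n / ((bj ℓ j : ℕ) : ℝ)))) :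
    ((((ℓ + 1) ^ k : ℕ)) : ℝ) ^ (d + 1) * |∑ j ∈ range k, T j|
      ≤ Cx * (((d + 1).factorial : ℝ) / (δ₁ * ρ / 2) ^ (d + 1)
          * (1 - Real.exp (-(δ₁ * ρ / 2 * ((ℓ : ℝ) + 1))))⁻¹)
        * Real.exp (-(δ₁ * ((ℓ : ℝ) + 1) / 2 * (n / ((((ℓ + 1) ^ k : ℕ)) : ℝ)))) := by
  set Lk : ℝ := ((((ℓ + 1) ^ k : ℕ)) : ℝ) with hLkdef
  have hLk : 0 < Lk := by rw [hLkdef]; positivity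
  have hD : ρ ≤ n / Lk := by rw [le_div_iff₀ hLk]; exact hn
  have hLkp : 0 ≤ Lk ^ (d + 1) := pow_nonneg hLk.le _
  -- termwise
  have hterm : ∀ j ∈ range k, Lk ^ (d + 1) * |T j|
      ≤ Cx * (sc ℓ k j ^ (d + 1) * Real.exp (-(δ₁ * (n / Lk) * sc ℓ k j))) := by
    intro j hj
    have hjk : j < k := mem_range.1 hj
    have hb : (0 : ℝ) < ((bj ℓ j : ℕ) : ℝ) ^ (d + 1) := by have := bj_pos ℓ j; positivity
    obtain ⟨hw0, hw1⟩ := hw j hjk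
    have h1 := hT j hjk
    have h2 : Cx * ((((bj ℓ j : ℕ) : ℝ) ^ (d + 1))⁻¹ * w j) * Real.exp (-(δ₁ * n / ((bj ℓ j : ℕ) : ℝ)))
        ≤ Cx * ((((bj ℓ j : ℕ) : ℝ) ^ (d + 1))⁻¹) * Real.exp (-(δ₁ * n / ((bj ℓ j : ℕ) : ℝ))) := by
      refine mul_le_mul_of_nonneg_right (mul_le_mul_of_nonneg_left ?_ hCx) (Real.exp_pos _).le
      exact mul_le_of_le_one_right (inv_pos.2 hb).le hw1
    have hexp : Real.exp (-(δ₁ * n / ((bj ℓ j : ℕ) : ℝ))) = Real.exp (-(δ₁ * (n / Lk) * sc ℓ k j)) := by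
      rw [mul_div_assoc, div_bj_eq hjk.le n, hLkdef]
      ring_nf
    have hpow : Lk ^ (d + 1) * ((((bj ℓ j : ℕ) : ℝ) ^ (d + 1))⁻¹) = sc ℓ k j ^ (d + 1) := by
      rw [hLkdef]
      exact Lk_pow_mul_inv_bj_pow hjk.le (d + 1)
    calc Lk ^ (d + 1) * |T j|
        ≤ Lk ^ (d + 1) * (Cx * ((((bj ℓ j : ℕ) : ℝ) ^ (d + 1))⁻¹) * Real.exp (-(δ₁ * n / ((bj ℓ j : ℕ) : ℝ)))) :=
          mul_le_mul_of_nonneg_left (h1.trans h2) hLkp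
      _ = Cx * ((Lk ^ (d + 1) * ((((bj ℓ j : ℕ) : ℝ) ^ (d + 1))⁻¹)) * Real.exp (-(δ₁ * n / ((bj ℓ j : ℕ) : ℝ)))) := by
          ring
      _ = Cx * (sc ℓ k j ^ (d + 1) * Real.exp (-(δ₁ * (n / Lk) * sc ℓ k j))) := by rw [hpow, hexp]
  have hS := scaleSum_sep_le hℓ hδ₁ hρ (d + 1) k hD
  calc Lk ^ (d + 1) * |∑ j ∈ range k, T j| ≤ Lk ^ (d + 1) * ∑ j ∈ range k, |T j| :=
        mul_le_mul_of_nonneg_left (abs_sum_le_sum_abs _ _) hLkp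
    _ = ∑ j ∈ range k, Lk ^ (d + 1) * |T j| := by rw [mul_sum]
    _ ≤ ∑ j ∈ range k, Cx * (sc ℓ k j ^ (d + 1) * Real.exp (-(δ₁ * (n / Lk) * sc ℓ k j))) := sum_le_sum hterm
    _ = Cx * ∑ j ∈ range k, sc ℓ k j ^ (d + 1) * Real.exp (-(δ₁ * (n / Lk) * sc ℓ k j)) := by rw [mul_sum]
    _ ≤ Cx * ((((d + 1).factorial : ℝ) / (δ₁ * ρ / 2) ^ (d + 1)
          * (1 - Real.exp (-(δ₁ * ρ / 2 * ((ℓ : ℝ) + 1))))⁻¹) * Real.exp (-(δ₁ * ((ℓ : ℝ) + 1) / 2 * (n / Lk)))) :=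
        mul_le_mul_of_nonneg_left hS hCx
    _ = _ := by ring

/-- kernel: the separation constant is positive. [folklore] -/
private theorem sepConst_pos {ℓ : ℕ} {δ₁ ρ : ℝ} (hδ₁ : 0 < δ₁) (hρ : 0 < ρ) (p : ℕ) :
    0 < ((p.factorial : ℝ) / (δ₁ * ρ / 2) ^ p * (1 - Real.exp (-(δ₁ * ρ / 2 * ((ℓ : ℝ) + 1))))⁻¹) := by
  have h1 : (0 : ℝ) < p.factorial := by exact_mod_cast Nat.factorial_pos p
  have h2 : 0 < (δ₁ * ρ / 2) ^ p := by positivity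
  have h3 : 0 < 1 - Real.exp (-(δ₁ * ρ / 2 * ((ℓ : ℝ) + 1))) := by
    have hL : (0 : ℝ) < (ℓ : ℝ) + 1 := by positivity
    have : Real.exp (-(δ₁ * ρ / 2 * ((ℓ : ℝ) + 1))) < 1 := Real.exp_lt_one_iff.2 (by
      have : 0 < δ₁ * ρ / 2 * ((ℓ : ℝ) + 1) := by positivity
      linarith)
    linarith
  positivity

section Clauses

variable {ℓ k : ℕ} {M : Fin (d + 1) → ℕ} {a m2 : ℝ}

/-- kernel: an entry of `G_k(□,0)` is the sum of the entries of its scale pieces. [cite: Balaban1983Higgs3, (2.6) p.424] -/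
theorem Gfine_top_apply (hk : 1 ≤ k) (x x' : ↥(boxDom (Nf ℓ k M))) :
    Gfine ℓ k M k a m2 x x' = ∑ j ∈ range k, piece ℓ k M j a m2 x x' := by
  rw [← sum_piece hk, Matrix.sum_apply]

end Clauses

/-- **B3 (3.1), kernel level, VALUE — the zero-field box propagator between separated points decays exponentially with no
singular prefactor.**  For every separation `ρ > 0` there are `δ₀ > 0`, `C > 0` (on `d`, `L`, the window, `ρ`) such that for
every `k ≥ 1` (`η = L^{−k}`), window point, box `□` and fine sites with `η|x−x′|_∞ ≥ ρ`:
`|G^η_k(□,0;x,x′)| = η^{−(d+1)}|G_k(□,0;x,x′)| ≤ C·e^{−δ₀·η|x−x′|_∞}` (`G_k(□,0) = Gfine ℓ k M k a m2 = (boxOpR (L^k) a_k m² M)⁻¹`).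
This is the sup-norm part of `‖hG_k(Ω,B̃)h′‖_{1,α} ≤ O(1)e^{−δ₀dist(□(v),□(v′))}` when `h, h′` localize in unit cubes at distance
`≥ 1` (take `ρ = 1`).  Print: *"Such a possibility is assured by the following estimates ‖hG_k(Ω,B̃)h′‖_{1,α} ≤ O(1)e^{−δ₀dist(□(v),□(v′))},
(3.1)"* — for the instance a consequence of (2.6) + (2.10) summed over the scales (`sum_pieces_sep_le`).
[cite: Balaban1983Higgs3, (3.1) p.432] -/
theorem abs_Gk_sep_le (d ℓ : ℕ) (hℓ : 1 ≤ ℓ) (amin aplus m2plus : ℝ) (ha : 0 < amin) {ρ : ℝ} (hρ : 0 < ρ) :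
    ∃ δ₀ C : ℝ, 0 < δ₀ ∧ 0 < C ∧ ∀ (k : ℕ), 1 ≤ k → ∀ (a m2 : ℝ), amin ≤ a → a ≤ aplus → 0 ≤ m2 → m2 ≤ m2plus →
      ∀ (M : Fin (d + 1) → ℕ), (∀ i, 1 ≤ M i) → ∀ (x x' : ↥(boxDom (Nf ℓ k M))),
        ρ * ((((ℓ + 1) ^ k : ℕ)) : ℝ) ≤ supNorm (x.1 - x'.1) →
        ((((ℓ + 1) ^ k : ℕ)) : ℝ) ^ (d + 1) * |Gfine ℓ k M k a m2 x x'|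
          ≤ C * Real.exp (-(δ₀ * (supNorm (x.1 - x'.1) / ((((ℓ + 1) ^ k : ℕ)) : ℝ)))) := by
  obtain ⟨δ₁, Cv, hδ₁, hCv, hP⟩ := abs_piece_le d ℓ hℓ amin aplus m2plus ha
  refine ⟨δ₁ * ((ℓ : ℝ) + 1) / 2, Cv * (((d + 1).factorial : ℝ) / (δ₁ * ρ / 2) ^ (d + 1)
      * (1 - Real.exp (-(δ₁ * ρ / 2 * ((ℓ : ℝ) + 1))))⁻¹), by positivity,
    mul_pos hCv (sepConst_pos hδ₁ hρ (d + 1)), ?_⟩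
  intro k hk a m2 h1 h2 h3 h4 M hM x x' hsep
  rw [Gfine_top_apply hk]
  refine sum_pieces_sep_le (d := d) hℓ hδ₁ hρ hCv.le (fun j => piece ℓ k M j a m2 x x')
    (fun j => (sc ℓ k j ^ 2)⁻¹) (fun j _ => ⟨by positivity, ?_⟩) hsep
    (fun j hj => hP k hk j hj a m2 h1 h2 h3 h4 M hM x x')
  exact inv_le_one_of_one_le₀ (one_le_pow₀ (one_le_sc ℓ k j))

/-- **B3 (3.1), kernel level, DERIVATIVE IN THE ROW VARIABLE** at separated arguments: for every `ρ > 0` there are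
`δ₀, C > 0` with `η^{−(d+1)}·|(∂^η_μG_k(□,0))(x,x′)| = (L^k)^{d+1}·L^k·|G_k(x+e_μ,x′) − G_k(x,x′)| ≤ C·e^{−δ₀·η|x−x′|_∞}` whenever
`η|x−x′|_∞ ≥ ρ` and `x, x+e_μ ∈ □` ((2.10)'s derivative clause summed, `B3Ineq210ZeroBox.abs_pieceDiff_le`).
[cite: Balaban1983Higgs3, (3.1) p.432] -/
theorem abs_GkDiff_sep_le (d ℓ : ℕ) (hℓ : 1 ≤ ℓ) (amin aplus m2plus : ℝ) (ha : 0 < amin) {ρ : ℝ} (hρ : 0 < ρ) :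
    ∃ δ₀ C : ℝ, 0 < δ₀ ∧ 0 < C ∧ ∀ (k : ℕ), 1 ≤ k → ∀ (a m2 : ℝ), amin ≤ a → a ≤ aplus → 0 ≤ m2 → m2 ≤ m2plus →
      ∀ (M : Fin (d + 1) → ℕ), (∀ i, 1 ≤ M i) →
        ∀ (μ : Fin (d + 1)) (x xe : ↥(boxDom (Nf ℓ k M))), xe.1 = x.1 + Pi.single μ 1 →
        ∀ (x' : ↥(boxDom (Nf ℓ k M))), ρ * ((((ℓ + 1) ^ k : ℕ)) : ℝ) ≤ supNorm (x.1 - x'.1) →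
          ((((ℓ + 1) ^ k : ℕ)) : ℝ) ^ (d + 1) *
              (((((ℓ + 1) ^ k : ℕ)) : ℝ) * |Gfine ℓ k M k a m2 xe x' - Gfine ℓ k M k a m2 x x'|)
            ≤ C * Real.exp (-(δ₀ * (supNorm (x.1 - x'.1) / ((((ℓ + 1) ^ k : ℕ)) : ℝ)))) := by
  obtain ⟨δ₁, Cd, hδ₁, hCd, hP⟩ := abs_pieceDiff_le d ℓ hℓ amin aplus m2plus ha
  refine ⟨δ₁ * ((ℓ : ℝ) + 1) / 2, Cd * (((d + 1).factorial : ℝ) / (δ₁ * ρ / 2) ^ (d + 1)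
      * (1 - Real.exp (-(δ₁ * ρ / 2 * ((ℓ : ℝ) + 1))))⁻¹), by positivity,
    mul_pos hCd (sepConst_pos hδ₁ hρ (d + 1)), ?_⟩
  intro k hk a m2 h1 h2 h3 h4 M hM μ x xe hxe x' hsep
  have hLk : (0 : ℝ) < (((ℓ + 1) ^ k : ℕ) : ℝ) := by positivity
  have hsum : ((((ℓ + 1) ^ k : ℕ)) : ℝ) * |Gfine ℓ k M k a m2 xe x' - Gfine ℓ k M k a m2 x x'|
      = |∑ j ∈ range k, (((ℓ + 1) ^ k : ℕ) : ℝ) * (piece ℓ k M j a m2 xe x' - piece ℓ k M j a m2 x x')| := by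
    rw [Gfine_top_apply hk, Gfine_top_apply hk, ← sum_sub_distrib, ← mul_sum, abs_mul, abs_of_pos hLk]
  rw [hsum]
  refine sum_pieces_sep_le (d := d) hℓ hδ₁ hρ hCd.le
    (fun j => (((ℓ + 1) ^ k : ℕ) : ℝ) * (piece ℓ k M j a m2 xe x' - piece ℓ k M j a m2 x x'))
    (fun j => (sc ℓ k j)⁻¹) (fun j _ => ⟨(inv_pos.2 (sc_pos ℓ k j)).le, inv_le_one_of_one_le₀ (one_le_sc ℓ k j)⟩)
    hsep (fun j hj => ?_)
  rw [abs_mul, abs_of_pos hLk]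
  exact hP k hk j hj a m2 h1 h2 h3 h4 M hM μ x xe hxe x'

/-- **B3 (3.1), kernel level, DERIVATIVE IN THE COLUMN VARIABLE** at separated arguments (from the row clause by the symmetry
`G_k(□,0;x,x′) = G_k(□,0;x′,x)`, `B4Thm110ZeroBox.Gfine_isSymm`): `(L^k)^{d+1}·L^k·|G_k(x,x′+e_ν) − G_k(x,x′)| ≤ C·e^{−δ₀·η|x−x′|_∞}`.
[cite: Balaban1983Higgs3, (3.1) p.432] -/
theorem abs_GkDiff'_sep_le (d ℓ : ℕ) (hℓ : 1 ≤ ℓ) (amin aplus m2plus : ℝ) (ha : 0 < amin) {ρ : ℝ} (hρ : 0 < ρ) :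
    ∃ δ₀ C : ℝ, 0 < δ₀ ∧ 0 < C ∧ ∀ (k : ℕ), 1 ≤ k → ∀ (a m2 : ℝ), amin ≤ a → a ≤ aplus → 0 ≤ m2 → m2 ≤ m2plus →
      ∀ (M : Fin (d + 1) → ℕ), (∀ i, 1 ≤ M i) → ∀ (x : ↥(boxDom (Nf ℓ k M)))
        (ν : Fin (d + 1)) (x' xe' : ↥(boxDom (Nf ℓ k M))), xe'.1 = x'.1 + Pi.single ν 1 →
        ρ * ((((ℓ + 1) ^ k : ℕ)) : ℝ) ≤ supNorm (x.1 - x'.1) →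
          ((((ℓ + 1) ^ k : ℕ)) : ℝ) ^ (d + 1) *
              (((((ℓ + 1) ^ k : ℕ)) : ℝ) * |Gfine ℓ k M k a m2 x xe' - Gfine ℓ k M k a m2 x x'|)
            ≤ C * Real.exp (-(δ₀ * (supNorm (x.1 - x'.1) / ((((ℓ + 1) ^ k : ℕ)) : ℝ)))) := by
  obtain ⟨δ₀, C, hδ₀, hC, h⟩ := abs_GkDiff_sep_le d ℓ hℓ amin aplus m2plus ha hρ
  refine ⟨δ₀, C, hδ₀, hC, fun k hk a m2 h1 h2 h3 h4 M hM x ν x' xe' hxe' hsep => ?_⟩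
  have hsym := Gfine_isSymm ℓ k M k a m2
  have hn : supNorm (x.1 - x'.1) = supNorm (x'.1 - x.1) := by
    rw [← B4TorusKernel.supNorm_neg, neg_sub]
  rw [hsym.apply xe' x, hsym.apply x' x, hn]
  rw [hn] at hsep
  exact h k hk a m2 h1 h2 h3 h4 M hM ν x' xe' hxe' x hsep

/-- kernel: `s^α·s^{−1} ≤ 1` for `s ≥ 1`, `α ≤ 1`. [folklore] -/
private theorem rpow_mul_inv_le_one {s α : ℝ} (hs : 1 ≤ s) (hα : α ≤ 1) : s ^ α * s⁻¹ ≤ 1 := by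
  have hs0 : 0 < s := lt_of_lt_of_le one_pos hs
  have h1 : s ^ α ≤ s := by
    calc s ^ α ≤ s ^ (1 : ℝ) := Real.rpow_le_rpow_of_exponent_le hs hα
      _ = s := Real.rpow_one s
  calc s ^ α * s⁻¹ ≤ s * s⁻¹ := mul_le_mul_of_nonneg_right h1 (inv_pos.2 hs0).le
    _ = 1 := mul_inv_cancel₀ hs0.ne'

/-- **B3 (3.1), kernel level, HÖLDER QUOTIENT OF THE ROW DERIVATIVE** at separated arguments, per exponent `0 ≤ α < 1`:
for every `ρ > 0` there are `δ₀, C > 0` (on `d`, `L`, the window, `ρ`, `α`) with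
`(L^k/|x₂−x₁|_∞)^α·(L^k)^{d+1}·L^k·|(G_k(x₂+e_μ,x) − G_k(x₂,x)) − (G_k(x₁+e_μ,x) − G_k(x₁,x))| ≤ C·e^{−δ₀·η·min(|x₁−x|_∞,|x₂−x|_∞)}`
whenever `η·min(|x₁−x|_∞,|x₂−x|_∞) ≥ ρ` — i.e. `|x₂−x₁|^{−α}|(∂^η_μG^η_k)(x₂,x) − (∂^η_μG^η_k)(x₁,x)| ≤ C·e^{−δ₀dist({x₁,x₂},x)}`,
the (1.9)/(2.11)-type clause summed over the scales (`B3Ineq211ZeroBox.abs_pieceDD_le`). [cite: Balaban1983Higgs3, (3.1) p.432] -/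
theorem abs_GkDD_sep_le (d ℓ : ℕ) (hℓ : 1 ≤ ℓ) (amin aplus m2plus : ℝ) (ha : 0 < amin) {α : ℝ} (hα0 : 0 ≤ α)
    (hα1 : α < 1) {ρ : ℝ} (hρ : 0 < ρ) :
    ∃ δ₀ C : ℝ, 0 < δ₀ ∧ 0 < C ∧ ∀ (k : ℕ), 1 ≤ k → ∀ (a m2 : ℝ), amin ≤ a → a ≤ aplus → 0 ≤ m2 → m2 ≤ m2plus →
      ∀ (M : Fin (d + 1) → ℕ), (∀ i, 1 ≤ M i) →
        ∀ (μ : Fin (d + 1)) (x₁ xe₁ x₂ xe₂ : ↥(boxDom (Nf ℓ k M))), xe₁.1 = x₁.1 + Pi.single μ 1 →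
          xe₂.1 = x₂.1 + Pi.single μ 1 → x₂.1 ≠ x₁.1 → ∀ (x : ↥(boxDom (Nf ℓ k M))),
          ρ * ((((ℓ + 1) ^ k : ℕ)) : ℝ) ≤ min (supNorm (x₁.1 - x.1)) (supNorm (x₂.1 - x.1)) →
          ((((ℓ + 1) ^ k : ℕ) : ℝ) / supNorm (x₂.1 - x₁.1)) ^ α *
              (((((ℓ + 1) ^ k : ℕ)) : ℝ) ^ (d + 1) *
                ((((ℓ + 1) ^ k : ℕ) : ℝ) * |(Gfine ℓ k M k a m2 xe₂ x - Gfine ℓ k M k a m2 x₂ x)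
                  - (Gfine ℓ k M k a m2 xe₁ x - Gfine ℓ k M k a m2 x₁ x)|))
            ≤ C * Real.exp (-(δ₀ * (min (supNorm (x₁.1 - x.1)) (supNorm (x₂.1 - x.1)) / ((((ℓ + 1) ^ k : ℕ)) : ℝ)))) := by
  obtain ⟨δ₁, CH, hδ₁, hCH, hP⟩ := abs_pieceDD_le d ℓ hℓ amin aplus m2plus ha hα0 hα1
  refine ⟨δ₁ * ((ℓ : ℝ) + 1) / 2, CH * (((d + 1).factorial : ℝ) / (δ₁ * ρ / 2) ^ (d + 1)
      * (1 - Real.exp (-(δ₁ * ρ / 2 * ((ℓ : ℝ) + 1))))⁻¹), by positivity,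
    mul_pos hCH (sepConst_pos hδ₁ hρ (d + 1)), ?_⟩
  intro k hk a m2 h1 h2 h3 h4 M hM μ x₁ xe₁ x₂ xe₂ hxe₁ hxe₂ hne x hsep
  have hLk : (0 : ℝ) < (((ℓ + 1) ^ k : ℕ) : ℝ) := by positivity
  set W : ℝ := ((((ℓ + 1) ^ k : ℕ) : ℝ) / supNorm (x₂.1 - x₁.1)) ^ α with hW
  have hW0 : 0 ≤ W := Real.rpow_nonneg (div_nonneg (Nat.cast_nonneg _) (supNorm_nonneg _)) α
  have hsum : W * (((((ℓ + 1) ^ k : ℕ)) : ℝ) ^ (d + 1) *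
        ((((ℓ + 1) ^ k : ℕ) : ℝ) * |(Gfine ℓ k M k a m2 xe₂ x - Gfine ℓ k M k a m2 x₂ x)
          - (Gfine ℓ k M k a m2 xe₁ x - Gfine ℓ k M k a m2 x₁ x)|))
      = ((((ℓ + 1) ^ k : ℕ)) : ℝ) ^ (d + 1) * |∑ j ∈ range k, W * ((((ℓ + 1) ^ k : ℕ) : ℝ) *
          ((piece ℓ k M j a m2 xe₂ x - piece ℓ k M j a m2 x₂ x)
            - (piece ℓ k M j a m2 xe₁ x - piece ℓ k M j a m2 x₁ x)))| := by
    rw [Gfine_top_apply hk, Gfine_top_apply hk, Gfine_top_apply hk, Gfine_top_apply hk, ← sum_sub_distrib,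
      ← sum_sub_distrib, ← sum_sub_distrib, ← mul_sum, ← mul_sum, abs_mul, abs_mul, abs_of_nonneg hW0,
      abs_of_pos hLk]
    ring
  rw [hsum]
  refine sum_pieces_sep_le (d := d) hℓ hδ₁ hρ hCH.le
    (fun j => W * ((((ℓ + 1) ^ k : ℕ) : ℝ) * ((piece ℓ k M j a m2 xe₂ x - piece ℓ k M j a m2 x₂ x)
      - (piece ℓ k M j a m2 xe₁ x - piece ℓ k M j a m2 x₁ x))))
    (fun j => sc ℓ k j ^ α * (sc ℓ k j)⁻¹)
    (fun j _ => ⟨mul_nonneg (Real.rpow_nonneg (sc_pos ℓ k j).le α) (inv_pos.2 (sc_pos ℓ k j)).le,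
      rpow_mul_inv_le_one (one_le_sc ℓ k j) hα1.le⟩)
    hsep (fun j hj => ?_)
  rw [abs_mul, abs_mul, abs_of_nonneg hW0, abs_of_pos hLk]
  exact hP k hk j hj a m2 h1 h2 h3 h4 M hM μ x₁ xe₁ x₂ xe₂ hxe₁ hxe₂ hne x

/-- **B3 (3.1), kernel level, HÖLDER QUOTIENT OF THE COLUMN DERIVATIVE IN THE COLUMN VARIABLE** (by symmetry from
`abs_GkDD_sep_le`): `(L^k/|x₂′−x₁′|_∞)^α·(L^k)^{d+1}·L^k·|(G_k(x,x₂′+e_ν) − G_k(x,x₂′)) − (G_k(x,x₁′+e_ν) − G_k(x,x₁′))|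
≤ C·e^{−δ₀·η·min(|x−x₁′|_∞,|x−x₂′|_∞)}`. [cite: Balaban1983Higgs3, (3.1) p.432] -/
theorem abs_GkDD'_sep_le (d ℓ : ℕ) (hℓ : 1 ≤ ℓ) (amin aplus m2plus : ℝ) (ha : 0 < amin) {α : ℝ} (hα0 : 0 ≤ α)
    (hα1 : α < 1) {ρ : ℝ} (hρ : 0 < ρ) :
    ∃ δ₀ C : ℝ, 0 < δ₀ ∧ 0 < C ∧ ∀ (k : ℕ), 1 ≤ k → ∀ (a m2 : ℝ), amin ≤ a → a ≤ aplus → 0 ≤ m2 → m2 ≤ m2plus →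
      ∀ (M : Fin (d + 1) → ℕ), (∀ i, 1 ≤ M i) → ∀ (x : ↥(boxDom (Nf ℓ k M)))
        (ν : Fin (d + 1)) (x₁' xe₁' x₂' xe₂' : ↥(boxDom (Nf ℓ k M))), xe₁'.1 = x₁'.1 + Pi.single ν 1 →
          xe₂'.1 = x₂'.1 + Pi.single ν 1 → x₂'.1 ≠ x₁'.1 →
          ρ * ((((ℓ + 1) ^ k : ℕ)) : ℝ) ≤ min (supNorm (x.1 - x₁'.1)) (supNorm (x.1 - x₂'.1)) →
          ((((ℓ + 1) ^ k : ℕ) : ℝ) / supNorm (x₂'.1 - x₁'.1)) ^ α *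
              (((((ℓ + 1) ^ k : ℕ)) : ℝ) ^ (d + 1) *
                ((((ℓ + 1) ^ k : ℕ) : ℝ) * |(Gfine ℓ k M k a m2 x xe₂' - Gfine ℓ k M k a m2 x x₂')
                  - (Gfine ℓ k M k a m2 x xe₁' - Gfine ℓ k M k a m2 x x₁')|))
            ≤ C * Real.exp (-(δ₀ * (min (supNorm (x.1 - x₁'.1)) (supNorm (x.1 - x₂'.1)) / ((((ℓ + 1) ^ k : ℕ)) : ℝ)))) := by
  obtain ⟨δ₀, C, hδ₀, hC, h⟩ := abs_GkDD_sep_le d ℓ hℓ amin aplus m2plus ha hα0 hα1 hρ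
  refine ⟨δ₀, C, hδ₀, hC, fun k hk a m2 h1 h2 h3 h4 M hM x ν x₁' xe₁' x₂' xe₂' hxe₁ hxe₂ hne hsep => ?_⟩
  have hsym := Gfine_isSymm ℓ k M k a m2
  have hn : ∀ z : ↥(boxDom (Nf ℓ k M)), supNorm (x.1 - z.1) = supNorm (z.1 - x.1) := fun z => by
    rw [← B4TorusKernel.supNorm_neg, neg_sub]
  rw [hsym.apply xe₂' x, hsym.apply x₂' x, hsym.apply xe₁' x, hsym.apply x₁' x, hn x₁', hn x₂']
  rw [hn x₁', hn x₂'] at hsep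
  exact h k hk a m2 h1 h2 h3 h4 M hM ν x₁' xe₁' x₂' xe₂' hxe₁ hxe₂ hne x hsep

/-- **B3 (3.1), kernel level, THE MIXED SECOND DIFFERENCE** at separated arguments: for every `ρ > 0` there are `δ₀, C > 0` with
`(L^k)^{d+1}·(L^k)²·|G_k(x+e_μ,x′+e_ν) − G_k(x,x′+e_ν) − G_k(x+e_μ,x′) + G_k(x,x′)| ≤ C·e^{−δ₀·η|x−x′|_∞}` whenever `η|x−x′|_∞ ≥ ρ`
(i.e. `|(∂^η_{μ,1}∂^η_{ν,2}G^η_k)(x,x′)| ≤ C·e^{−δ₀dist}`; `abs_pieceMixed_le` summed). It controls the Hölder quotient of the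
row derivative in the column variable (and vice versa) of the two-variable field `hG_kh′`. [cite: Balaban1983Higgs3, (3.1) p.432] -/
theorem abs_GkMixed_sep_le (d ℓ : ℕ) (hℓ : 1 ≤ ℓ) (amin aplus m2plus : ℝ) (ha : 0 < amin) {ρ : ℝ} (hρ : 0 < ρ) :
    ∃ δ₀ C : ℝ, 0 < δ₀ ∧ 0 < C ∧ ∀ (k : ℕ), 1 ≤ k → ∀ (a m2 : ℝ), amin ≤ a → a ≤ aplus → 0 ≤ m2 → m2 ≤ m2plus →
      ∀ (M : Fin (d + 1) → ℕ), (∀ i, 1 ≤ M i) →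
        ∀ (μ ν : Fin (d + 1)) (x xe : ↥(boxDom (Nf ℓ k M))), xe.1 = x.1 + Pi.single μ 1 →
        ∀ (x' xe' : ↥(boxDom (Nf ℓ k M))), xe'.1 = x'.1 + Pi.single ν 1 →
          ρ * ((((ℓ + 1) ^ k : ℕ)) : ℝ) ≤ supNorm (x.1 - x'.1) →
          ((((ℓ + 1) ^ k : ℕ)) : ℝ) ^ (d + 1) *
              (((((ℓ + 1) ^ k : ℕ)) : ℝ) ^ 2 * |(Gfine ℓ k M k a m2 xe xe' - Gfine ℓ k M k a m2 x xe')
                - (Gfine ℓ k M k a m2 xe x' - Gfine ℓ k M k a m2 x x')|)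
            ≤ C * Real.exp (-(δ₀ * (supNorm (x.1 - x'.1) / ((((ℓ + 1) ^ k : ℕ)) : ℝ)))) := by
  obtain ⟨δ₁, Cm, hδ₁, hCm, hP⟩ := abs_pieceMixed_le d ℓ hℓ amin aplus m2plus ha
  refine ⟨δ₁ * ((ℓ : ℝ) + 1) / 2, Cm * (((d + 1).factorial : ℝ) / (δ₁ * ρ / 2) ^ (d + 1)
      * (1 - Real.exp (-(δ₁ * ρ / 2 * ((ℓ : ℝ) + 1))))⁻¹), by positivity,
    mul_pos hCm (sepConst_pos hδ₁ hρ (d + 1)), ?_⟩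
  intro k hk a m2 h1 h2 h3 h4 M hM μ ν x xe hxe x' xe' hxe' hsep
  have hLk : (0 : ℝ) < (((ℓ + 1) ^ k : ℕ) : ℝ) := by positivity
  have hLk2 : (0 : ℝ) < ((((ℓ + 1) ^ k : ℕ) : ℝ)) ^ 2 := by positivity
  have hsum : ((((ℓ + 1) ^ k : ℕ)) : ℝ) ^ 2 * |(Gfine ℓ k M k a m2 xe xe' - Gfine ℓ k M k a m2 x xe')
        - (Gfine ℓ k M k a m2 xe x' - Gfine ℓ k M k a m2 x x')|
      = |∑ j ∈ range k, ((((ℓ + 1) ^ k : ℕ)) : ℝ) ^ 2 * ((piece ℓ k M j a m2 xe xe' - piece ℓ k M j a m2 x xe')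
          - (piece ℓ k M j a m2 xe x' - piece ℓ k M j a m2 x x'))| := by
    rw [Gfine_top_apply hk, Gfine_top_apply hk, Gfine_top_apply hk, Gfine_top_apply hk, ← sum_sub_distrib,
      ← sum_sub_distrib, ← sum_sub_distrib, ← mul_sum, abs_mul, abs_of_pos hLk2]
  rw [hsum]
  refine sum_pieces_sep_le (d := d) hℓ hδ₁ hρ hCm.le
    (fun j => ((((ℓ + 1) ^ k : ℕ)) : ℝ) ^ 2 * ((piece ℓ k M j a m2 xe xe' - piece ℓ k M j a m2 x xe')
      - (piece ℓ k M j a m2 xe x' - piece ℓ k M j a m2 x x')))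
    (fun _ => 1) (fun j _ => ⟨zero_le_one, le_rfl⟩) hsep (fun j hj => ?_)
  rw [abs_mul, abs_of_pos hLk2, mul_one]
  exact hP k hk j hj a m2 h1 h2 h3 h4 M hM μ ν x xe hxe x' xe' hxe'

/-! ## §4 Non-vacuity: the binders are inhabited (`d + 1 = 3`, `L = 2`, window `[1/2, 2] × [0, 1]`, `ρ = 1`, `k = 1`,
the cube `4 × 4 × 4` of fine sites, two corners at sup-distance `3 ≥ ρL^k = 2`) -/

/-- The value clause at an explicit configuration: the constants exist and the bound is a genuine inequality between
real numbers. [cite: Balaban1983Higgs3, (3.1) p.432] -/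
theorem abs_Gk_sep_le_witness :
    ∃ δ₀ C : ℝ, 0 < δ₀ ∧ 0 < C ∧
      ∀ (x x' : ↥(boxDom (Nf 1 1 (fun _ : Fin 3 => 4)))),
        (1 : ℝ) * ((((1 + 1) ^ 1 : ℕ)) : ℝ) ≤ supNorm (x.1 - x'.1) →
        ((((1 + 1) ^ 1 : ℕ)) : ℝ) ^ (2 + 1) * |Gfine 1 1 (fun _ : Fin 3 => 4) 1 (1 : ℝ) (1 / 2 : ℝ) x x'|
          ≤ C * Real.exp (-(δ₀ * (supNorm (x.1 - x'.1) / ((((1 + 1) ^ 1 : ℕ)) : ℝ)))) := by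
  obtain ⟨δ₀, C, hδ₀, hC, h⟩ := abs_Gk_sep_le 2 1 le_rfl (1 / 2) 2 1 (by norm_num) (ρ := 1) one_pos
  exact ⟨δ₀, C, hδ₀, hC, fun x x' hsep =>
    h 1 le_rfl 1 (1 / 2) (by norm_num) (by norm_num) (by norm_num) (by norm_num) _ (fun _ => by norm_num) x x' hsep⟩

end

end Literature.MathematicalPhysics.QuantumFieldTheory.Balaban1983to89.B3GkZeroBoxSeparated
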